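import Summits.ValiantsHypothesis.ValiantsHypothesis.Theses.ValuativeGCT
import Literature.Computability.AlgebraicComplexity.ValiantClassesProofs
import Literature.Computability.Complexity.OccurrenceObstructionsBIP
import Literature.NumberTheory.DiophantineGeometry.SchurWeylPlethysmOrbitWeightsProofs
import Literature.NumberTheory.DiophantineGeometry.SchurWeylPlethysmCoordRepWeightsProofs
import Literature.Computability.AlgebraicComplexity.MultiplicityObstructionsProofs

/-!
# Disproof of `ValuativeFlip` (crux stmt-ValiantsHypothesis-12624, route ValuativeGCT) — findings

Standing adversary file (refuter, cdisprove mode).  Prose lives in docstrings; every `theorem`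
below is sorry-free unless it sits in the final `NearMisses` section.

VERDICT SO FAR: the crux SURVIVES cheap refutation; it is an honest open problem (a valuative
sharpening of the Mulmuley–Sohoni multiplicity flip), not misstated.  Summary of findings:

* **F1 Window bookkeeping** (`§ Window`, `§ Consequences`).  `c = 0` is vacuous
  (`flip_at_zero`); `c = 1` forces the SQUARE CASE `m = n` (`squareCase_of_valuativeFlip`) and
  the smallest PADDED case `m = n + 1` (`succCase_of_valuativeFlip`);
  for every `c₀` some window contains `m = max n (n ^ c₀)`, whence the kill criterion
  `NoValuativeFlip → ¬ ValuativeFlip` (`not_valuativeFlip_of_noValuativeFlip`) and the BIP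
  regime `m ≥ n ^ 25` lies inside the statement.
* **F2 The square case is free (paper, n ≥ 3).**  With `U = ⊥` the truncation `T_⊥(λ)` is the
  space of `Stab(det_n)`-invariant highest-weight vectors of weight `λ*` in `ℂ[End W]_{nδ}`,
  i.e. `(S_λ W)^H`, `H = Stab_{GL(W)}(det_n)` acting on the right; `⊕_λ V_λ^* ⊗ T_⊥(λ)` is the
  degree-`nδ` part of `ℂ[End W]^H`, an algebra of Krull dimension `n⁴ - dim H = n⁴ - 2n² + 2`
  (generic right `H`-orbits in `End W` are closed with trivial stabiliser), so
  `Σ_λ dim T_⊥(λ)·dim V_λ = O(δ^{n⁴-2n²+1})`, while `dim ℂ[Δ(per_n)]_δ ≍ δ^{n⁴-2n+1}` because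
  `dim Stab(per_n) = 2n - 2` for `n ≥ 3` (Marcus–May 1962 / Botta 1967).  Hence for `δ ≫ 0` some
  `λ ⊢ nδ` has `mult_{λ*} ℂ[Δ per_n] > dim T_⊥(λ) ≥ dim T_U(λ)`: `FlipBody n n` HOLDS, by counting,
  with no valuation at all (and fails at `n = 2`, `per₂ ≅ det₂`, as it must).  For `m ≥ n + 1`
  the count reverses (`dim Δ(X₀₀^{m-n} per_n) ≈ (n²+1)m² < m⁴ - 2m² + 2`), so the content of the
  crux is exactly the padded range `n < m ≤ 2^{(log₂ n + c)^c}` — recorded as the sorried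
  near-miss `squareCase` below (not formalisable today: needs Cauchy decomposition of `ℂ[End W]`,
  Hilbert polynomials and the two stabiliser dimensions).
* **F3 Why it resists refutation.**  `¬ ValuativeFlip` ⇔ for one `c` and infinitely many `n`
  there is `m` in the window with `mult_{λ*} ℂ[Δ pp] ≤ dim T_U(λ)` for ALL `(U, r, δ, λ)` — a
  "no valuative multiplicity obstruction" theorem, i.e. `NoValuativeFlip` (stmt-12629) in a
  window; this is stronger than "no multiplicity obstructions", which is open (BIP,
  arXiv:1604.06431, p. 2, rule out OCCURRENCE obstructions only for `m ≥ n^25`; IP17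
  arXiv:1512.03798 Thm 4 concerns positivity of Kronecker coefficients only).  By F2 the
  refuting `m` must moreover be a PADDED case `m > n`.  Sandwich (conventions audited, coherent):
  `K_m(λ) ≤ dim T_U(λ) ≤ dim T_⊥(λ) = dim (S_λ W)^{Stab det_m}` for every admissible `(U, r)`, so
  `sk-flip ⇒ ValuativeFlip ⇒ (with ValuativeBound) GctMultFlip`: sandwiched between two open
  statements; no barrier of `Literature/Barriers/ValiantsHypothesis/` produces a counterexample.
* **F4 Load-bearing hypotheses** (`§ LoadBearing`).  The rank bound `∀ u ∈ U, rank u ≤ r` is the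
  ONLY thing separating the statement from triviality: without it `U = ⊤, r = 0` gives
  `I(L_⊤) = ⊥`, `T = ⊥` (`truncT_top_zero_eq_bot`) and the flip holds at the one-row weight,
  whose padded-permanent multiplicity is positive (`orbitMultiplicity_paddedPer_oneRow_pos`):
  `valuativeFlipWithoutRankBound_holds`.  Any proof must therefore USE the rank bound, i.e. the
  valuation must see that `U` is a space of singular matrices.  Dropping `n ≤ m` or the
  eventuality `∃ n₀` lets `m = 1` in (`pp = det₁ = x`, `T ∋ X^δ`, every multiplicity `≤ 1`):
  FALSE — `not_flipBody_one`, `not_valuativeFlipWithoutLowerWindow`, `not_valuativeFlipAllN`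
  (`§ MOne`).  The clause `lam.parts.card ≤ m*m` is cosmetic
  under `∃`; the homogeneity clause of `T` is REDUNDANT — implied by the Borel clause at
  `g = 2 • 1` (weight pins degree): `isHomogeneous_of_mem_borelPart`, `truncT_eq_dropHomogeneous`
  (`§ Redundancy`).
* **F5 Degenerate witnesses give nothing for free**: `δ = 0` (`T = ℂ`, multiplicity `1`),
  `U = ⊥ ∧ r = 0` (`𝔪^{mδ} ⊇ homog_{mδ}`: no cut, `truncT_bot_zero`), `r ≥ m` (exponent `0`,
  `truncT_of_le`): all reduce to the symmetric-Kronecker space `T₀ = T_⊥`.  Monotonicity for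
  provers: `truncT_anti_space` (larger `U` cuts more), `truncT_mono_rank` (smaller `r` cuts
  more); and the sk-flip is formally sufficient: `flipBody_of_truncT₀_lt`.
* **F5b No flip at one-row shapes** (`§ OneRow`): `mult_{(mδ)*} ℂ[Δ(X₀₀^{m-n} per_n)] = 1`
  exactly (`orbitMultiplicity_paddedPer_oneRow_eq_one`; `≤ 1` for EVERY orbit closure and every
  one-row dual weight, `orbitMultiplicity_single_top_le_one`), while — granted the support item
  `CoeffVanishingOrder` (stmt-12628, provable now; its instance `d = x_top^m` is identified with
  `det(A_top)` in `coeffVanishingOrder_top`) — `det(A_top)^δ ∈ T_U((mδ)*)` for every admissible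
  `(U, r)` (`rowTopDet_pow_mem_truncT`).  Hence `no_oneRow_flip`: witnesses need `≥ 2` rows.
* **F6 The cut is invisible on the null cone** (`§ NullCone`, the main structural theorem of
  this file).  The `End`-stabiliser of `det_m` contains the row/column torus; invariance forces
  every monomial of every `G ∈ T₀` to carry degree exactly `δ` in each row-group and each
  column-group of matrix positions (`rowDeg_eq_and_colDeg_eq_of_mem_truncT₀`, a "magic square"),
  hence degree `≥ (|S|+|T|-m)δ` in any block `S × T` (`le_blockDeg`).  So for every `U` inside a
  coordinate compression space `blockSpace S T` with `|S|+|T| ≥ m + (m-r)` the valuative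
  condition is automatic: `truncT_eq_truncT₀_of_le_blockSpace` (`T_U = T₀`; e.g. matrices with a
  common zero row / column, `truncT_zeroRow`, `truncT_zeroCol`).  TRANSPORT is formalised too:
  the cut only sees the `Stab(det_m)`-orbit of `U` (`truncT_eq_truncT₀_of_stab_transport`;
  `X ↦ P X Q` multiplies `det_m` by `det P det Q`, `linSubst_kronLex_detFormLex`), whence
  `truncT_eq_truncT₀_of_equiv_compression`: if `det P det Q = 1` and `P u Q` has zero block
  `S × T` (`|S|+|T| ≥ m + (m-r)`) for all `u ∈ U`, then `T_U = T₀`.  This covers EVERY compression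
  space `{u | u V ⊆ V'}`, `dim V - dim V' ≥ m - r`, i.e. (King / IQS / Derksen–Makam) the whole
  null cone of the left-right action = the singular spaces of nc-rank `≤ r`.  So a `ValuativeFlip`
  witness with `nc-rank(U) ≤ r` is already a symmetric-Kronecker (`U = ⊥`) witness: the crux is
  EXACTLY "Edmonds-gap valuations beat the padded permanent", as the planner intends, and it
  inherits the full difficulty of the sk-flip unless `CutBites` (stmt-12626) holds for the chosen
  Edmonds-gap family.

* **F7 CutBites holds at `m = 3` (kit job j006072, exact arithmetic; script
  `kit_cutbites/cutbites_m3.py`).**  For `δ = 2`, `λ = (2,2,2)`: an element of `T₀((2,2,2)*)`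
  depends only on the three greatest rows `r₇, r₈, r₉` of `A`, with `GL₃`-highest weight
  `(2,2,2)`, hence (FFT for `SL₃`) is `q(r₇ ∧ r₈ ∧ r₉)` for a quadratic form `q` on `Λ³ℂ⁹`
  invariant under `Stab(det₃)` (`sl₃ ⊕ sl₃` and the transpose swap acting on `ℂ⁹ = ℂ³ ⊗ ℂ³`).
  Computation: the invariant forms are ONE-dimensional (numerical null space 93 → 1, then
  rationalised with error `1.2e-13` and re-verified EXACTLY over `ℚ`: 84 nonzero entries), so
  `dim T₀((2,2,2)*) = 1 = sk`, spanned by `G₀ = q₀ ∘ Plücker`, `G₀ ≢ 0` (value `-13280` at a random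
  integer point).  Along `L_Λ` (`Λ = ` skew `3 × 3`, `r = 2`, threshold `δ(m-r) = 2`):
  `G₀(z + t·s)` (`z` skew rows, `s` symmetric directions, 6 random rational trials) has constant
  term `-24·D(z)² ≠ 0` (`-57624 = -24·49²`, `-15000 = -24·25²`, `-40344 = -24·41²`, …) and only
  even powers of `t` (transpose symmetry).  So `G₀ ∉ I(L_Λ)` — it does not even vanish on `L_Λ`
  (`v_Λ(G₀) = 0`) — a fortiori `G₀ ∉ I(L_Λ)²`: `T_Λ((2,2,2)*) = 0 < 1 = T₀((2,2,2)*)`.  The card's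
  table `(1,1,0)` vs `(1,1,1)` on `(6), (4,2), (2,2,2)` is CONFIRMED (the first two entries pass
  the cut automatically, being pull-backs from `ℂ[Δ det₃]`).  Consequence for this crux: the
  Edmonds-gap valuation is a genuine, non-vacuous sharpening of the symmetric Kronecker bound at
  `m = 3`; nothing here refutes `ValuativeFlip`, and the disprover's remaining hope is the padded
  per-side (F3), not the det-side cut.

Conventions (readback of the elaborated term, W.lean rc 0): `linSubst A (X i) = Σ_j A j i • X j`
(column convention, covariant); `σ_M : X_(j,i) ↦ Σ_l M l i • X_(j,l)` is `G ↦ G(A·M)`;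
`ρ_g : X_(j,i) ↦ Σ_l (g⁻¹) j l • X_(l,i)` is `G ↦ G(g⁻¹·A)`, the transport of `coordRep`
(`(g·F)(v) = F(g⁻¹v)`) under `Φ(F)(A) = F(linSubst A det_m)`; `L_U = {A | every ROW of A ∈ U}`;
weight `χ = (dualOfPartition (m*m) λ).toMatIdx` has size `-mδ`, matching End-degree `mδ` and
coefficient-degree `δ`.
-/

noncomputable section

set_option linter.dupNamespace false

namespace Summit.ValiantsHypothesis.ValiantsHypothesis.Cruxes.ValuativeFlip.Disproof

open Literature.NumberTheory.DiophantineGeometry Literature.Computability.AlgebraicComplexity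
open Summit.ValiantsHypothesis.ValiantsHypothesis.Theses.ValuativeGCT
open MvPolynomial

/-! ## Names for the pieces of the crux -/

/-- The weight `λ* = (0,…,0,-λ_ℓ,…,-λ₁)` of a partition `λ ⊢ mδ`, transported to `MatIdx m`
(the `let χ` of the crux). -/
abbrev flipWeight (m δ : ℕ) (lam : Nat.Partition (m * δ)) : Weight (MatIdx m) :=
  (Weight.dualOfPartition (m * m) lam).toMatIdx

/-- The VALUATIVE TRUNCATION `T_U(χ)` of the crux (its `let T`, with the weight abstracted):
degree-`mδ` polynomial functions on `End(ℂ^{MatIdx m})` lying in `I(L_U)^{δ(m-r)}`, invariant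
under the right action of the `End`-stabiliser of `det_m`, and `B`-semi-invariant of weight `χ`
for `G ↦ G(g⁻¹ A)`. -/
def truncT (m : ℕ) (U : Submodule ℂ (MatIdx m → ℂ)) (r δ : ℕ) (χ : Weight (MatIdx m)) :
    Submodule ℂ (MvPolynomial (MatIdx m × MatIdx m) ℂ) :=
  MvPolynomial.homogeneousSubmodule (MatIdx m × MatIdx m) ℂ (m * δ) ⊓
    ((MvPolynomial.vanishingIdeal ℂ
      {p : MatIdx m × MatIdx m → ℂ | ∀ j : MatIdx m, (fun i => p (j, i)) ∈ U}) ^ (δ * (m - r))).restrictScalars ℂ ⊓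
    (⨅ (M : Matrix (MatIdx m) (MatIdx m) ℂ) (_ : linSubst (MatIdx m) ℂ M (detFormLex ℂ m) = detFormLex ℂ m),
      LinearMap.ker ((MvPolynomial.aeval (R := ℂ) fun p : MatIdx m × MatIdx m =>
        ∑ l : MatIdx m, M l p.2 • MvPolynomial.X (p.1, l)).toLinearMap -
        LinearMap.id (R := ℂ) (M := MvPolynomial (MatIdx m × MatIdx m) ℂ))) ⊓
    (⨅ (g : Matrix.GeneralLinearGroup (MatIdx m) ℂ) (_ : IsUpperTriangular g),
      LinearMap.ker ((MvPolynomial.aeval (R := ℂ) fun p : MatIdx m × MatIdx m =>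
        ∑ l : MatIdx m, ((g⁻¹ : Matrix.GeneralLinearGroup (MatIdx m) ℂ) :
          Matrix (MatIdx m) (MatIdx m) ℂ) p.1 l • MvPolynomial.X (l, p.2)).toLinearMap -
        weightChar χ g • LinearMap.id (R := ℂ) (M := MvPolynomial (MatIdx m × MatIdx m) ℂ)))

/-- The rank bound of the crux: every matrix of `U` has rank `≤ r`. -/
def RankLE (m : ℕ) (U : Submodule ℂ (MatIdx m → ℂ)) (r : ℕ) : Prop :=
  ∀ u ∈ U, (Matrix.of fun a b : Fin m => u (toLex (a, b))).rank ≤ r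

/-- The body of the crux at `(n, m)`: some admissible truncation is strictly smaller than the
padded-permanent multiplicity. -/
def FlipBody (n m : ℕ) [NeZero m] : Prop :=
  ∃ (U : Submodule ℂ (MatIdx m → ℂ)) (r δ : ℕ) (lam : Nat.Partition (m * δ)),
    RankLE m U r ∧ lam.parts.card ≤ m * m ∧
      Module.finrank ℂ ↥(truncT m U r δ (flipWeight m δ lam)) <
        orbitMultiplicity ℂ (paddedPerFormLex ℂ n m) m (flipWeight m δ lam)

/-- The crux, unfolded into the named pieces (definitional). -/
theorem valuativeFlip_iff :
    ValuativeFlip ↔ ∀ c : ℕ, ∃ n₀ : ℕ, ∀ n ≥ n₀, ∀ (m : ℕ) [NeZero m],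
      n ≤ m → m ≤ 2 ^ ((Nat.log 2 n + c) ^ c) → FlipBody n m :=
  Iff.rfl

/-- The kill statement `NoValuativeFlip` (stmt-12629), unfolded into the named pieces
(definitional). -/
theorem noValuativeFlip_iff :
    NoValuativeFlip ↔ ∃ c₀ n₀ : ℕ, ∀ n ≥ n₀, ∀ (m : ℕ) [NeZero m], n ^ c₀ ≤ m →
      ∀ (U : Submodule ℂ (MatIdx m → ℂ)) (r : ℕ), RankLE m U r →
        ∀ (δ : ℕ) (lam : Nat.Partition (m * δ)), lam.parts.card ≤ m * m →
          orbitMultiplicity ℂ (paddedPerFormLex ℂ n m) m (flipWeight m δ lam) ≤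
            Module.finrank ℂ ↥(truncT m U r δ (flipWeight m δ lam)) :=
  Iff.rfl

/-! ## Window bookkeeping -/

/-- For `c = 0` the window `n ≤ m ≤ 2^((log₂ n + 0)^0) = 2` is empty as soon as `n ≥ 3`. -/
theorem window_zero_empty {n m : ℕ} (hn : 3 ≤ n) (h1 : n ≤ m)
    (h2 : m ≤ 2 ^ ((Nat.log 2 n + 0) ^ 0)) : False := by
  rw [pow_zero, pow_one] at h2
  omega

/-- The `c = 0` instance of the crux holds vacuously (it carries no content). -/
theorem flip_at_zero : ∃ n₀ : ℕ, ∀ n ≥ n₀, ∀ (m : ℕ) [NeZero m],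
    n ≤ m → m ≤ 2 ^ ((Nat.log 2 n + 0) ^ 0) → FlipBody n m :=
  ⟨3, fun _ hn _ _ h1 h2 => (window_zero_empty hn h1 h2).elim⟩

/-- Every `n` lies in its own window for `c = 1`: `n ≤ 2^(⌊log₂ n⌋ + 1)`. -/
theorem self_mem_window_one (n : ℕ) : n ≤ 2 ^ ((Nat.log 2 n + 1) ^ 1) := by
  rw [pow_one]
  exact (Nat.lt_pow_succ_log_self Nat.one_lt_two n).le

/-- For every exponent `c₀` some window contains the polynomial padding `m = max n (n ^ c₀)`
uniformly in `n` (via `IsPBounded.isQPBounded`, BCS Def. (21.31)). -/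
theorem exists_window_contains_pow (c₀ : ℕ) :
    ∃ c : ℕ, ∀ n : ℕ, max n (n ^ c₀) ≤ 2 ^ ((Nat.log 2 n + c) ^ c) := by
  have hP : IsPBounded fun n => max n (n ^ c₀) := by
    refine ⟨c₀ + 1, fun n => ?_⟩
    rcases Nat.eq_zero_or_pos n with rfl | hn
    · simp only [Nat.zero_le, max_eq_right]
      exact (pow_le_one₀ (le_refl 0) zero_le_one).trans (by omega)
    · refine max_le ?_ ?_
      · calc n = n ^ 1 := (pow_one n).symm
          _ ≤ n ^ (c₀ + 1) := Nat.pow_le_pow_right hn (by omega)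
          _ ≤ n ^ (c₀ + 1) + (c₀ + 1) := Nat.le_add_right _ _
      · calc n ^ c₀ ≤ n ^ (c₀ + 1) := Nat.pow_le_pow_right hn (by omega)
          _ ≤ n ^ (c₀ + 1) + (c₀ + 1) := Nat.le_add_right _ _
  obtain ⟨c, hc⟩ := hP.isQPBounded
  exact ⟨c, hc⟩

/-! ## Consequences of the crux (what any proof must in particular deliver) -/

/-- **The square case is forced.**  `ValuativeFlip` (at `c = 1`, `m = n`) implies that for all
large `n` some admissible truncation for `det_n` is strictly smaller than the corresponding
multiplicity in `ℂ[Δ(per_n)]` (no padding).  By finding F2 of the module docstring this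
consequence is TRUE for `n ≥ 3` (Hilbert-function count), so it is not a refutation route. -/
theorem squareCase_of_valuativeFlip (h : ValuativeFlip) :
    ∃ n₀ : ℕ, ∀ n ≥ n₀, ∀ [NeZero n], FlipBody n n := by
  obtain ⟨n₀, hn₀⟩ := (valuativeFlip_iff.mp h) 1
  exact ⟨n₀, fun n hn _ => hn₀ n hn n le_rfl (self_mem_window_one n)⟩

/-- **The smallest padded case is forced too.**  The `c = 1` window contains `m = n + 1`
(`n + 1 ≤ 2^(⌊log₂ n⌋+1)`), so any proof of the crux produces, for all large `n`, a valuative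
multiplicity obstruction for `X₀₀ · per_n` versus `det_{n+1}` — and a disproof of that single
family of instances refutes the crux.  Unlike the square case (F2) no counting argument decides
it: `dim Δ(X₀₀ per_n) ≈ (n²+1)(n+1)² < dim Δ(det_{n+1})`. -/
theorem succCase_of_valuativeFlip (h : ValuativeFlip) :
    ∃ n₀ : ℕ, ∀ n ≥ n₀, FlipBody n (n + 1) := by
  obtain ⟨n₀, hn₀⟩ := (valuativeFlip_iff.mp h) 1
  refine ⟨n₀, fun n hn => hn₀ n hn (n + 1) (Nat.le_succ n) ?_⟩
  rw [pow_one]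
  exact Nat.lt_pow_succ_log_self Nat.one_lt_two n

/-- **Kill criterion (route text: "NoValuativeFlip proved ⇒ ValuativeFlip is refuted inside the
window").**  The negative-side item stmt-12629 refutes the crux: its polynomial padding
`m = max n (n^c₀)` lies in the window of `c` from `exists_window_contains_pow`. -/
theorem not_valuativeFlip_of_noValuativeFlip (hno : NoValuativeFlip) : ¬ ValuativeFlip := by
  intro hflip
  obtain ⟨c₀, n₀, hno⟩ := noValuativeFlip_iff.mp hno
  obtain ⟨c, hc⟩ := exists_window_contains_pow c₀
  obtain ⟨n₁, hflip⟩ := (valuativeFlip_iff.mp hflip) c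
  set n : ℕ := max (max n₀ n₁) 1 with hn
  set m : ℕ := max n (n ^ c₀) with hm
  have hn1 : 1 ≤ n := le_max_right _ _
  haveI : NeZero m := ⟨by omega⟩
  obtain ⟨U, r, δ, lam, hU, hcard, hlt⟩ :=
    hflip n ((le_max_right _ _).trans (le_max_left _ _)) m (le_max_left _ _) (hc n)
  have hle := hno n ((le_max_left _ _).trans (le_max_left _ _)) m (le_max_right _ _) U r hU δ
    lam hcard
  exact absurd hlt (not_lt.mpr hle)


/-! ## Degenerate parameters give no cut (F5) -/

/-- The untruncated space `T₀(χ)`: `Stab(det_m)`-invariant `B`-semi-invariants of weight `χ` in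
degree `mδ` (the symmetric-Kronecker space of BLMW Prop. 5.2.1 when `χ = λ*`). -/
def truncT₀ (m δ : ℕ) (χ : Weight (MatIdx m)) : Submodule ℂ (MvPolynomial (MatIdx m × MatIdx m) ℂ) :=
  MvPolynomial.homogeneousSubmodule (MatIdx m × MatIdx m) ℂ (m * δ) ⊓
    (⨅ (M : Matrix (MatIdx m) (MatIdx m) ℂ) (_ : linSubst (MatIdx m) ℂ M (detFormLex ℂ m) = detFormLex ℂ m),
      LinearMap.ker ((MvPolynomial.aeval (R := ℂ) fun p : MatIdx m × MatIdx m =>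
        ∑ l : MatIdx m, M l p.2 • MvPolynomial.X (p.1, l)).toLinearMap -
        LinearMap.id (R := ℂ) (M := MvPolynomial (MatIdx m × MatIdx m) ℂ))) ⊓
    (⨅ (g : Matrix.GeneralLinearGroup (MatIdx m) ℂ) (_ : IsUpperTriangular g),
      LinearMap.ker ((MvPolynomial.aeval (R := ℂ) fun p : MatIdx m × MatIdx m =>
        ∑ l : MatIdx m, ((g⁻¹ : Matrix.GeneralLinearGroup (MatIdx m) ℂ) :
          Matrix (MatIdx m) (MatIdx m) ℂ) p.1 l • MvPolynomial.X (l, p.2)).toLinearMap -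
        weightChar χ g • LinearMap.id (R := ℂ) (M := MvPolynomial (MatIdx m × MatIdx m) ℂ)))

/-- `T_U(χ) ≤ T₀(χ)` always: the valuative condition only cuts. -/
theorem truncT_le_truncT₀ (m : ℕ) (U : Submodule ℂ (MatIdx m → ℂ)) (r δ : ℕ) (χ : Weight (MatIdx m)) :
    truncT m U r δ χ ≤ truncT₀ m δ χ := by
  intro G hG
  simp only [truncT, Submodule.mem_inf] at hG
  simp only [truncT₀, Submodule.mem_inf]
  exact ⟨⟨hG.1.1.1, hG.1.2⟩, hG.2⟩

/-- If the valuative ideal condition is implied by homogeneity, the truncation is `T₀`. -/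
theorem truncT_eq_truncT₀_of_le {m : ℕ} {U : Submodule ℂ (MatIdx m → ℂ)} {r δ : ℕ}
    (h : MvPolynomial.homogeneousSubmodule (MatIdx m × MatIdx m) ℂ (m * δ) ≤
      ((MvPolynomial.vanishingIdeal ℂ
        {p : MatIdx m × MatIdx m → ℂ | ∀ j : MatIdx m, (fun i => p (j, i)) ∈ U}) ^ (δ * (m - r))).restrictScalars ℂ)
    (χ : Weight (MatIdx m)) : truncT m U r δ χ = truncT₀ m δ χ := by
  refine le_antisymm (truncT_le_truncT₀ m U r δ χ) fun G hG => ?_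
  simp only [truncT₀, Submodule.mem_inf] at hG
  simp only [truncT, Submodule.mem_inf]
  exact ⟨⟨⟨hG.1.1, h hG.1.1⟩, hG.1.2⟩, hG.2⟩

/-- **`r ≥ m` gives no cut**: the exponent `δ(m-r)` is `0` and `I^0 = ⊤`. -/
theorem truncT_of_le {m r : ℕ} (hmr : m ≤ r) (U : Submodule ℂ (MatIdx m → ℂ)) (δ : ℕ)
    (χ : Weight (MatIdx m)) : truncT m U r δ χ = truncT₀ m δ χ := by
  refine truncT_eq_truncT₀_of_le (fun G _ => ?_) χ
  rw [Nat.sub_eq_zero_of_le hmr, mul_zero, pow_zero, Ideal.one_eq_top]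
  trivial

/-- **`U = ⊥, r = 0` gives no cut**: `L_⊥ = {0}`, `I(L_⊥) ⊇ (X)` and every form of degree
`mδ` lies in `(X)^{mδ}`.  So the "smallest space, smallest rank" witness is the untruncated
symmetric-Kronecker space `T₀` (BLMW's bound), not a free flip. -/
theorem truncT_bot_zero (m δ : ℕ) (χ : Weight (MatIdx m)) : truncT m ⊥ 0 δ χ = truncT₀ m δ χ := by
  refine truncT_eq_truncT₀_of_le (fun G hG => ?_) χ
  rw [Nat.sub_zero, Submodule.restrictScalars_mem]
  have hvars : MvPolynomial.idealOfVars (MatIdx m × MatIdx m) ℂ ≤ MvPolynomial.vanishingIdeal ℂ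
      {p : MatIdx m × MatIdx m → ℂ | ∀ j : MatIdx m, (fun i => p (j, i)) ∈ (⊥ : Submodule ℂ (MatIdx m → ℂ))} := by
    rw [MvPolynomial.idealOfVars, Ideal.span_le]
    rintro _ ⟨ji, rfl⟩ p hp
    have hp0 : p = 0 := by
      funext q
      have := hp q.1
      rw [Submodule.mem_bot] at this
      exact congr_fun this q.2
    simp [hp0]
  refine Ideal.pow_right_mono hvars _ ?_
  rw [MvPolynomial.mem_pow_idealOfVars_iff]
  intro x hx
  have hGh : G.IsHomogeneous (m * δ) := (MvPolynomial.mem_homogeneousSubmodule _ _).mp hG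
  rw [Finsupp.degree_eq_weight_one, mul_comm]
  exact (hGh (MvPolynomial.mem_support_iff.mp hx)).symm.le

/-- **Monotonicity in the space**: a larger `U` cuts more (`L_U ⊆ L_{U'}`, so
`I(L_{U'}) ⊆ I(L_U)`).  Provers should take `U` maximal among spaces of rank `≤ r`. -/
theorem truncT_anti_space {m : ℕ} {U U' : Submodule ℂ (MatIdx m → ℂ)} (h : U ≤ U') (r δ : ℕ)
    (χ : Weight (MatIdx m)) : truncT m U' r δ χ ≤ truncT m U r δ χ := by
  intro G hG
  simp only [truncT, Submodule.mem_inf, Submodule.restrictScalars_mem] at hG ⊢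
  refine ⟨⟨⟨hG.1.1.1, ?_⟩, hG.1.2⟩, hG.2⟩
  have hsub : {p : MatIdx m × MatIdx m → ℂ | ∀ j : MatIdx m, (fun i => p (j, i)) ∈ U} ⊆
      {p : MatIdx m × MatIdx m → ℂ | ∀ j : MatIdx m, (fun i => p (j, i)) ∈ U'} := by
    intro p hp
    simp only [Set.mem_setOf_eq] at hp ⊢
    exact fun j => h (hp j)
  exact Ideal.pow_right_mono (MvPolynomial.vanishingIdeal_anti_mono hsub) _ hG.1.1.2

/-- **Monotonicity in the rank bound**: a smaller `r` cuts more.  Provers should take `r` = the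
maximal rank on `U`. -/
theorem truncT_mono_rank {m : ℕ} (U : Submodule ℂ (MatIdx m → ℂ)) {r r' : ℕ} (h : r ≤ r') (δ : ℕ)
    (χ : Weight (MatIdx m)) : truncT m U r δ χ ≤ truncT m U r' δ χ := by
  intro G hG
  simp only [truncT, Submodule.mem_inf, Submodule.restrictScalars_mem] at hG ⊢
  refine ⟨⟨⟨hG.1.1.1, ?_⟩, hG.1.2⟩, hG.2⟩
  exact Ideal.pow_le_pow_right (Nat.mul_le_mul_left δ (Nat.sub_le_sub_left h m)) hG.1.1.2

/-- **The sk-flip implies the crux body** (formal version of "implied by GctKroneckerFlip"): a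
strict inequality already for the untruncated symmetric-Kronecker space `T₀` is a witness with
`U = ⊥`, `r = 0`. -/
theorem flipBody_of_truncT₀_lt {n m : ℕ} [NeZero m] {δ : ℕ} {lam : Nat.Partition (m * δ)}
    (hcard : lam.parts.card ≤ m * m)
    (hlt : Module.finrank ℂ ↥(truncT₀ m δ (flipWeight m δ lam)) <
      orbitMultiplicity ℂ (paddedPerFormLex ℂ n m) m (flipWeight m δ lam)) : FlipBody n m := by
  refine ⟨⊥, 0, δ, lam, fun u hu => ?_, hcard, ?_⟩
  · rw [(Submodule.mem_bot ℂ).mp hu]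
    have : (Matrix.of fun a b : Fin m => (0 : MatIdx m → ℂ) (toLex (a, b))) = 0 := by
      ext a b; rfl
    rw [this, Matrix.rank_zero]
  · rwa [truncT_bot_zero]

/-! ## Load-bearing hypotheses (F4) -/

section LoadBearing

/-- `L_⊤` is the whole space of endomorphisms. -/
theorem rowsIn_top (m : ℕ) :
    {p : MatIdx m × MatIdx m → ℂ | ∀ j : MatIdx m, (fun i => p (j, i)) ∈ (⊤ : Submodule ℂ (MatIdx m → ℂ))} =
      Set.univ := by
  ext p
  simp

/-- Over `ℂ` no nonzero polynomial vanishes on the whole affine space. -/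
theorem vanishingIdeal_univ {σ : Type*} :
    MvPolynomial.vanishingIdeal ℂ (Set.univ : Set (σ → ℂ)) = ⊥ := by
  refine (Submodule.eq_bot_iff _).mpr fun p hp => ?_
  rw [MvPolynomial.mem_vanishingIdeal_iff] at hp
  refine MvPolynomial.funext fun x => ?_
  rw [map_zero]
  exact hp x (Set.mem_univ x)

/-- **The rank bound is load-bearing**: without it, `U = ⊤`, `r = 0` makes the valuative ideal
`I(L_⊤)^{δm} = ⊥^{δm} = ⊥`, hence `T = ⊥` in every positive degree. -/
theorem truncT_top_zero_eq_bot (m δ : ℕ) (h : 0 < δ * m) (χ : Weight (MatIdx m)) :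
    truncT m ⊤ 0 δ χ = ⊥ := by
  rw [truncT, rowsIn_top, vanishingIdeal_univ, Nat.sub_zero, ← Ideal.zero_eq_bot, zero_pow h.ne',
    Ideal.zero_eq_bot, Submodule.restrictScalars_bot]
  simp

/-- The greatest matrix index `(m-1, m-1)` for the lexicographic order. -/
def topIdx (m : ℕ) [NeZero m] : MatIdx m :=
  toLex (Fin.rev (0 : Fin m), Fin.rev (0 : Fin m))

/-- `topIdx m` is the greatest element of `MatIdx m`. -/
theorem le_topIdx (m : ℕ) [NeZero m] (i : MatIdx m) : i ≤ topIdx m := by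
  rcases h : ofLex i with ⟨a, b⟩
  have hi : i = toLex (a, b) := by rw [← h, toLex_ofLex]
  rw [hi, topIdx, Prod.Lex.toLex_le_toLex]
  rcases (Fin.le_rev_iff.mpr (Fin.zero_le _) : a ≤ Fin.rev 0).lt_or_eq with hlt | heq
  · exact Or.inl hlt
  · exact Or.inr ⟨heq, Fin.le_rev_iff.mpr (Fin.zero_le _)⟩

/-- The lexicographic enumeration sends the last index of `Fin (m*m)` to `topIdx m`. -/
theorem matIdxEquiv_symm_topIdx_val (m : ℕ) [NeZero m] :
    (((matIdxEquiv m).symm (topIdx m) : Fin (m * m)) : ℕ) = m * m - 1 := by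
  have hmm : m * m - 1 < m * m := Nat.sub_one_lt (by simpa using NeZero.ne m)
  set t := (matIdxEquiv m).symm (topIdx m) with ht
  have h1 : (⟨m * m - 1, hmm⟩ : Fin (m * m)) ≤ t := by
    rw [ht, ← (matIdxEquiv m).le_iff_le, OrderIso.apply_symm_apply]
    exact le_topIdx m _
  have h2 : (t : ℕ) < m * m := t.2
  exact le_antisymm (by omega) h1

/-- **The one-row weight.**  For `δ = 1` and `λ = (m)` the crux weight `λ*` is `-m ε_{topIdx}`. -/
theorem flipWeight_indiscrete (m : ℕ) [NeZero m] :
    flipWeight m 1 (Nat.Partition.indiscrete (m * 1)) = Pi.single (topIdx m) (-(m : ℤ)) := by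
  have hm : m * 1 ≠ 0 := by simpa using NeZero.ne m
  have hsorted : (Nat.Partition.indiscrete (m * 1)).sortedParts = [m * 1] := by
    simp [Nat.Partition.sortedParts, Nat.Partition.indiscrete_parts hm]
  have hmm : m * m - 1 < m * m := Nat.sub_one_lt (by simpa using NeZero.ne m)
  funext ij
  simp only [flipWeight, Weight.toMatIdx, Weight.dualOfPartition, Weight.dual, Weight.ofPartition,
    hsorted]
  by_cases hij : ij = topIdx m
  · subst hij
    have hrev : ((Fin.rev ((matIdxEquiv m).symm (topIdx m)) : Fin (m * m)) : ℕ) = 0 := by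
      rw [Fin.val_rev, matIdxEquiv_symm_topIdx_val]
      omega
    rw [Pi.single_eq_same, hrev, List.getD_cons_zero, mul_one]
  · rw [Pi.single_eq_of_ne hij]
    have hne : (matIdxEquiv m).symm ij ≠ (matIdxEquiv m).symm (topIdx m) :=
      fun h => hij ((matIdxEquiv m).symm.injective h)
    have hval : (((matIdxEquiv m).symm ij : Fin (m * m)) : ℕ) ≠ m * m - 1 := by
      intro h
      apply hne
      ext
      rw [h, matIdxEquiv_symm_topIdx_val]
    have hlt : (((matIdxEquiv m).symm ij : Fin (m * m)) : ℕ) < m * m := ((matIdxEquiv m).symm ij).2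
    obtain ⟨k, hk⟩ : ∃ k, ((Fin.rev ((matIdxEquiv m).symm ij) : Fin (m * m)) : ℕ) = k + 1 :=
      ⟨(m * m - 1 - ((matIdxEquiv m).symm ij : ℕ)) - 1, by rw [Fin.val_rev]; omega⟩
    rw [hk, List.getD_cons_succ, List.getD_nil, Nat.cast_zero, neg_zero]

/-- The padded permanent takes the value `n!` at the all-ones matrix (`n ≤ m`). -/
theorem eval_one_paddedPerFormLex (n m : ℕ) [NeZero m] (hnm : n ≤ m) :
    MvPolynomial.eval (fun _ => (1 : ℂ)) (paddedPerFormLex ℂ n m) = (n.factorial : ℂ) := by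
  rw [Literature.Computability.Complexity.paddedPerFormLex_eq, map_mul, map_pow, MvPolynomial.eval_X, one_pow,
    one_mul, MvPolynomial.eval_rename]
  have hcomp : ((fun _ : MatIdx m => (1 : ℂ)) ∘ fun ij : BlockIdx n m × BlockIdx n m =>
      (toLex ((ij.1 : Fin m), (ij.2 : Fin m)) : MatIdx m)) = fun _ => 1 := rfl
  rw [hcomp, eval_perPoly]
  simp only [Matrix.permanent, Matrix.of_apply, Finset.prod_const_one, Finset.sum_const,
    Finset.card_univ, Fintype.card_perm, card_blockIdx hnm, nsmul_eq_mul, mul_one]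

/-- **The coordinate of `x_{topIdx}^m` does not vanish on the orbit of the padded permanent**
(`n ≤ m`): at the unipotent `g = 1 + E`, `E` = the row `topIdx` filled with ones off the
diagonal, the coefficient of `x_{topIdx}^m` in `g · pp` is `pp(1,…,1) = n! ≠ 0`. -/
theorem X_top_not_mem_orbitVanishingIdeal_paddedPer (n m : ℕ) [NeZero m] (hnm : n ≤ m)
    (d : DegIdx (MatIdx m) m) (hd : d.1 = Finsupp.single (topIdx m) m) :
    (X d : MvPolynomial (DegIdx (MatIdx m) m) ℂ) ∉ orbitVanishingIdeal (paddedPerFormLex ℂ n m) m := by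
  classical
  set iₘ : MatIdx m := topIdx m with hiₘ
  set E : Matrix (MatIdx m) (MatIdx m) ℂ := Matrix.of fun j i => if j = iₘ ∧ i ≠ iₘ then 1 else 0
    with hE
  have hE2 : E * E = 0 := by
    ext j i
    rw [Matrix.mul_apply, Matrix.zero_apply]
    refine Finset.sum_eq_zero fun l _ => ?_
    by_cases hl : l = iₘ
    · have : E j l = 0 := by
        rw [hE, Matrix.of_apply, if_neg]
        exact fun h => h.2 hl
      rw [this, zero_mul]
    · have : E l i = 0 := by
        rw [hE, Matrix.of_apply, if_neg]
        exact fun h => hl h.1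
      rw [this, mul_zero]
  set g : GL (MatIdx m) ℂ := ⟨1 + E, 1 - E,
    by rw [add_mul, mul_sub, mul_sub, one_mul, one_mul, mul_one, hE2]; abel,
    by rw [sub_mul, mul_add, mul_add, one_mul, one_mul, mul_one, hE2]; abel⟩ with hg
  rw [mem_orbitVanishingIdeal_iff, not_forall]
  refine ⟨g, ?_⟩
  rw [MvPolynomial.aeval_X, formCoeff_apply, linSubstRep_apply, hd]
  change MvPolynomial.coeff (Finsupp.single iₘ m) (linSubst _ ℂ (1 + E) (paddedPerFormLex ℂ n m)) ≠ 0
  rw [← Literature.Computability.Complexity.eval_pi_single_of_isHomogeneous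
    (linSubst_isHomogeneous _ (paddedPerFormLex_isHomogeneous ℂ hnm)) iₘ,
    Literature.Computability.Complexity.eval_linSubst]
  have hrow : (fun i => ∑ j, (1 + E) j i * (Pi.single iₘ (1 : ℂ) : MatIdx m → ℂ) j) =
      fun _ => (1 : ℂ) := by
    funext i
    rw [Finset.sum_eq_single iₘ (fun j _ hj => by rw [Pi.single_eq_of_ne hj, mul_zero])
      (fun h => absurd (Finset.mem_univ iₘ) h), Pi.single_eq_same, mul_one, Matrix.add_apply,
      Matrix.one_apply, hE, Matrix.of_apply]
    by_cases hi : iₘ = i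
    · simp [hi]
    · simp [hi, Ne.symm hi]
  rw [hrow, eval_one_paddedPerFormLex n m hnm, Nat.cast_ne_zero]
  exact Nat.factorial_ne_zero n

/-- **The one-row multiplicity of the padded permanent is positive** (`n ≤ m`): the class of the
coordinate `X_{x_{top}^m}` is a nonzero `B`-semi-invariant of weight `-m ε_{top} = (m)*` in
`ℂ[Δ(X₀₀^{m-n} per_n)]`, and highest-weight spaces there are finite-dimensional
(`finiteDimensional_highestWeightSpace_orbitCoordRep_holds`). -/
theorem orbitMultiplicity_paddedPer_oneRow_pos (n m : ℕ) [NeZero m] (hnm : n ≤ m) :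
    0 < orbitMultiplicity ℂ (paddedPerFormLex ℂ n m) m (Pi.single (topIdx m) (-(m : ℤ))) := by
  classical
  have hdeg : (Finsupp.single (topIdx m) m : MatIdx m →₀ ℕ) ∈ degMonomials (MatIdx m) m := by
    rw [mem_degMonomials_iff, Finsupp.degree_single]
  set d : DegIdx (MatIdx m) m := ⟨_, hdeg⟩ with hd
  have hX := Literature.Computability.Complexity.X_mem_highestWeightSpace_coordRep (k := ℂ) m (topIdx m)
    (le_topIdx m) d rfl
  have hmk := mk_mem_highestWeightSpace_orbitCoordRep (paddedPerFormLex ℂ n m) hX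
  have hne : Ideal.Quotient.mk (orbitVanishingIdeal (paddedPerFormLex ℂ n m) m)
      (X d : MvPolynomial (DegIdx (MatIdx m) m) ℂ) ≠ 0 := fun h0 =>
    X_top_not_mem_orbitVanishingIdeal_paddedPer n m hnm d rfl (Ideal.Quotient.eq_zero_iff_mem.mp h0)
  haveI := finiteDimensional_highestWeightSpace_orbitCoordRep_holds (k := ℂ) (paddedPerFormLex ℂ n m)
    (NeZero.ne m) (Pi.single (topIdx m) (-(m : ℤ)))
  rw [orbitMultiplicity, hwMultiplicity]
  exact Module.finrank_pos_iff_exists_ne_zero.mpr ⟨⟨_, hmk⟩, fun h => hne (congrArg Subtype.val h)⟩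

/-- The crux with the rank bound `∀ u ∈ U, rank u ≤ r` DELETED (everything else verbatim, in
the named pieces). -/
def ValuativeFlipWithoutRankBound : Prop :=
  ∀ c : ℕ, ∃ n₀ : ℕ, ∀ n ≥ n₀, ∀ (m : ℕ) [NeZero m], n ≤ m → m ≤ 2 ^ ((Nat.log 2 n + c) ^ c) →
    ∃ (U : Submodule ℂ (MatIdx m → ℂ)) (r δ : ℕ) (lam : Nat.Partition (m * δ)),
      lam.parts.card ≤ m * m ∧
        Module.finrank ℂ ↥(truncT m U r δ (flipWeight m δ lam)) <
          orbitMultiplicity ℂ (paddedPerFormLex ℂ n m) m (flipWeight m δ lam)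

/-- **Any proof of the crux must use the rank bound**: without it the statement is trivially
TRUE (`U = ⊤`, `r = 0`, `δ = 1`, `λ = (m)`: `finrank T = 0 < 1 ≤ mult`).  Equivalently: the
valuation has to know that `U` consists of SINGULAR matrices; a proof that never uses
`rank ≤ r < m` proves this triviality instead. -/
theorem valuativeFlipWithoutRankBound_holds : ValuativeFlipWithoutRankBound := by
  intro c
  refine ⟨0, fun n _ m _ hnm _ => ⟨⊤, 0, 1, Nat.Partition.indiscrete (m * 1), ?_, ?_⟩⟩
  · have hm : m * 1 ≠ 0 := by simpa using NeZero.ne m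
    rw [Nat.Partition.indiscrete_parts hm, Multiset.card_singleton]
    exact NeZero.one_le.trans (Nat.le_mul_self m)
  · rw [truncT_top_zero_eq_bot m 1 (by simpa using NeZero.pos m), finrank_bot, flipWeight_indiscrete]
    exact orbitMultiplicity_paddedPer_oneRow_pos n m hnm

end LoadBearing


/-! ## The cut is invisible on the null cone (coordinate compression spaces)

If `U` lies in a coordinate COMPRESSION SPACE `blockSpace S T = {u | u_{ab} = 0 (a ∈ S, b ∈ T)}`
with `|S| + |T| ≥ m + (m - r)` (so that every matrix of `U` has rank `≤ r`), then the valuative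
condition of the crux is AUTOMATIC: `T_U(χ) = T₀(χ)`.  Mechanism: the `End`-stabiliser of `det_m`
contains the row/column torus `x_{ab} ↦ d_a e_b x_{ab}` (`∏ d ∏ e = 1`); invariance under it forces
every monomial of `G ∈ T₀` to have degree exactly `δ` in each row-group and each column-group of
positions (a "magic square" of multidegrees), hence degree `≥ (|S|+|T|-m)δ ≥ δ(m-r)` in the block
variables, i.e. membership in `I(L_U)^{δ(m-r)}`.  Every singular space with a shrunk subspace
(nc-rank `≤ r`; King / Ivanyos–Qiao–Subrahmanyam / Derksen–Makam null-cone criterion for the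
left-right action) is `Stab(det_m)`-conjugate to a subspace of such a `blockSpace`, so — up to the
(unformalised) transport `T_{g·U} ≅ T_U` — the crux can only be witnessed by spaces of
non-commutative rank `> r` (Edmonds-gap spaces), exactly as the route intends; choosing `U` in the
null cone reduces `ValuativeFlip` to the symmetric-Kronecker flip at `U = ⊥`. -/

section NullCone

variable {m : ℕ}

/-- If every element of `T₀` already satisfies the valuative condition, the truncation is `T₀`. -/
theorem truncT_eq_truncT₀_of_forall {U : Submodule ℂ (MatIdx m → ℂ)} {r δ : ℕ} {χ : Weight (MatIdx m)}
    (h : ∀ G ∈ truncT₀ m δ χ, G ∈ ((MvPolynomial.vanishingIdeal ℂ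
        {p : MatIdx m × MatIdx m → ℂ | ∀ j : MatIdx m, (fun i => p (j, i)) ∈ U}) ^ (δ * (m - r))).restrictScalars ℂ) :
    truncT m U r δ χ = truncT₀ m δ χ := by
  refine le_antisymm (truncT_le_truncT₀ m U r δ χ) fun G hG => ?_
  have hI := h G hG
  simp only [truncT₀, Submodule.mem_inf] at hG
  simp only [truncT, Submodule.mem_inf]
  exact ⟨⟨⟨hG.1.1, hI⟩, hG.1.2⟩, hG.2⟩

/-- Row of the matrix position of the variable `X_(j,i)`, `i = (a,b)`: `a`. -/
abbrev rowOfVar (p : MatIdx m × MatIdx m) : Fin m := (ofLex p.2).1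

/-- Column of the matrix position of the variable `X_(j,i)`, `i = (a,b)`: `b`. -/
abbrev colOfVar (p : MatIdx m × MatIdx m) : Fin m := (ofLex p.2).2

/-- Degree of a monomial in the variables of row-group `a`. -/
def rowDeg (a : Fin m) (n : MatIdx m × MatIdx m →₀ ℕ) : ℕ :=
  ∑ p ∈ n.support with rowOfVar p = a, n p

/-- Degree of a monomial in the variables of column-group `b`. -/
def colDeg (b : Fin m) (n : MatIdx m × MatIdx m →₀ ℕ) : ℕ :=
  ∑ p ∈ n.support with colOfVar p = b, n p

/-- Degree of a monomial in the block variables `S × T`. -/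
def blockDeg (S T : Finset (Fin m)) (n : MatIdx m × MatIdx m →₀ ℕ) : ℕ :=
  ∑ p ∈ n.support with (rowOfVar p ∈ S ∧ colOfVar p ∈ T), n p

/-- A diagonal rescaling of the variables multiplies a monomial by a character. -/
theorem aeval_smul_X_monomial {σ : Type*} (w : σ → ℂ) (n : σ →₀ ℕ) (c : ℂ) :
    MvPolynomial.aeval (fun p => w p • (X p : MvPolynomial σ ℂ)) (monomial n c) =
      (n.prod fun p k => w p ^ k) • monomial n c := by
  rw [MvPolynomial.aeval_monomial, MvPolynomial.algebraMap_eq, Finsupp.prod]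
  simp only [smul_eq_C_mul, mul_pow, Finset.prod_mul_distrib, ← map_pow, ← map_prod]
  rw [MvPolynomial.monomial_eq, Finsupp.prod, Finsupp.prod]
  ring

/-- Coefficients under a diagonal rescaling of the variables. -/
theorem coeff_aeval_smul_X {σ : Type*} (w : σ → ℂ) (G : MvPolynomial σ ℂ) (n : σ →₀ ℕ) :
    MvPolynomial.coeff n (MvPolynomial.aeval (fun p => w p • (X p : MvPolynomial σ ℂ)) G) =
      (n.prod fun p k => w p ^ k) * MvPolynomial.coeff n G := by
  classical
  induction G using MvPolynomial.induction_on' with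
  | monomial s a =>
    rw [aeval_smul_X_monomial, MvPolynomial.coeff_smul, MvPolynomial.coeff_monomial, smul_eq_mul]
    by_cases h : s = n
    · subst h; simp
    · simp [h]
  | add p q hp hq => rw [map_add, MvPolynomial.coeff_add, MvPolynomial.coeff_add, hp, hq, mul_add]

/-- Invariance under a diagonal rescaling forces the character to be trivial on the support. -/
theorem prod_pow_eq_one_of_aeval_smul_X_eq {σ : Type*} {w : σ → ℂ} {G : MvPolynomial σ ℂ}
    (h : MvPolynomial.aeval (fun p => w p • (X p : MvPolynomial σ ℂ)) G = G) {n : σ →₀ ℕ}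
    (hn : n ∈ G.support) : (n.prod fun p k => w p ^ k) = 1 := by
  have hc : MvPolynomial.coeff n G ≠ 0 := MvPolynomial.mem_support_iff.mp hn
  have := congrArg (MvPolynomial.coeff n) h
  rw [coeff_aeval_smul_X] at this
  exact mul_right_cancel₀ hc (this.trans (one_mul _).symm)

/-- The generic matrix in the lexicographic variables. -/
def lexVarMatrix (m : ℕ) : Matrix (Fin m) (Fin m) (MvPolynomial (MatIdx m) ℂ) :=
  Matrix.of fun a b => X (toLex (a, b))

/-- `det_m` in the lexicographic variables is the determinant of `lexVarMatrix`. -/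
theorem detFormLex_eq_det (m : ℕ) : detFormLex ℂ m = (lexVarMatrix m).det := by
  rw [detFormLex, detPoly, AlgHom.map_det]
  congr 1
  ext a b
  simp [lexVarMatrix, Matrix.mvPolynomialX, AlgHom.mapMatrix_apply, MvPolynomial.rename_X]

/-- **The row/column torus stabilises `det_m`**: `x_{ab} ↦ d_a e_b x_{ab}` with `∏ d · ∏ e = 1`
fixes the determinant (`det (D X E) = det D det X det E`). -/
theorem linSubst_torus_detFormLex (d e : Fin m → ℂ) (h : (∏ a, d a) * (∏ b, e b) = 1) :
    linSubst (MatIdx m) ℂ (Matrix.diagonal fun i : MatIdx m => d (ofLex i).1 * e (ofLex i).2)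
      (detFormLex ℂ m) = detFormLex ℂ m := by
  rw [detFormLex_eq_det, AlgHom.map_det]
  have hmap : (linSubst (MatIdx m) ℂ (Matrix.diagonal fun i : MatIdx m => d (ofLex i).1 * e (ofLex i).2)).mapMatrix
      (lexVarMatrix m) = Matrix.diagonal (fun a => C (d a)) * lexVarMatrix m * Matrix.diagonal (fun b => C (e b)) := by
    ext a b
    rw [AlgHom.mapMatrix_apply, Matrix.map_apply, Matrix.mul_diagonal, Matrix.diagonal_mul, lexVarMatrix,
      Matrix.of_apply, linSubst_X, Finset.sum_eq_single (toLex (a, b))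
        (fun j _ hj => by rw [Matrix.diagonal_apply_ne _ hj, zero_smul])
        (fun h => absurd (Finset.mem_univ _) h), Matrix.diagonal_apply_eq, smul_eq_C_mul, map_mul]
    simp only [ofLex_toLex]
    ring
  rw [hmap, Matrix.det_mul, Matrix.det_mul, Matrix.det_diagonal, Matrix.det_diagonal, ← map_prod, ← map_prod]
  calc C (∏ a, d a) * (lexVarMatrix m).det * C (∏ b, e b)
      = C ((∏ a, d a) * ∏ b, e b) * (lexVarMatrix m).det := by rw [map_mul]; ring
    _ = (lexVarMatrix m).det := by rw [h, map_one, one_mul]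

/-- The right `End`-stabiliser substitution `σ_M` of the crux for a diagonal `M = diag(w)` is the
rescaling `X_(j,i) ↦ w_i X_(j,i)`. -/
theorem stabSubst_diagonal (w : MatIdx m → ℂ) :
    (fun p : MatIdx m × MatIdx m => ∑ l : MatIdx m, (Matrix.diagonal w) l p.2 • (X (p.1, l) : MvPolynomial (MatIdx m × MatIdx m) ℂ)) =
      fun p => w p.2 • X p := by
  funext p
  rw [Finset.sum_eq_single p.2 (fun l _ hl => by rw [Matrix.diagonal_apply_ne _ hl, zero_smul])
    (fun h => absurd (Finset.mem_univ _) h), Matrix.diagonal_apply_eq]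

/-- Stabiliser invariance of an element of `T₀`, for one `M`. -/
theorem aeval_eq_of_mem_truncT₀ {δ : ℕ} {χ : Weight (MatIdx m)} {G : MvPolynomial (MatIdx m × MatIdx m) ℂ}
    (hG : G ∈ truncT₀ m δ χ) (M : Matrix (MatIdx m) (MatIdx m) ℂ)
    (hM : linSubst (MatIdx m) ℂ M (detFormLex ℂ m) = detFormLex ℂ m) :
    MvPolynomial.aeval (R := ℂ) (fun p : MatIdx m × MatIdx m => ∑ l : MatIdx m, M l p.2 • MvPolynomial.X (p.1, l)) G = G := by
  simp only [truncT₀, Submodule.mem_inf, Submodule.mem_iInf, LinearMap.mem_ker, LinearMap.sub_apply,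
    LinearMap.id_apply, AlgHom.toLinearMap_apply, sub_eq_zero] at hG
  exact hG.1.2 M hM

/-- Homogeneity degree of an element of `T₀`. -/
theorem isHomogeneous_of_mem_truncT₀ {δ : ℕ} {χ : Weight (MatIdx m)} {G : MvPolynomial (MatIdx m × MatIdx m) ℂ}
    (hG : G ∈ truncT₀ m δ χ) : G.IsHomogeneous (m * δ) := by
  simp only [truncT₀, Submodule.mem_inf] at hG
  exact (MvPolynomial.mem_homogeneousSubmodule _ _).mp hG.1.1

/-- **Magic-square multidegrees, I**: for `G ∈ T₀` every monomial has the same degree in each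
row-group as in each column-group (torus `d = 2` at row `a`, `e = 1/2` at column `b`). -/
theorem rowDeg_eq_colDeg_of_mem_truncT₀ {δ : ℕ} {χ : Weight (MatIdx m)} {G : MvPolynomial (MatIdx m × MatIdx m) ℂ}
    (hG : G ∈ truncT₀ m δ χ) {n : MatIdx m × MatIdx m →₀ ℕ} (hn : n ∈ G.support) (a b : Fin m) :
    rowDeg a n = colDeg b n := by
  classical
  set d : Fin m → ℂ := fun a' => if a' = a then 2 else 1 with hd
  set e : Fin m → ℂ := fun b' => if b' = b then 2⁻¹ else 1 with he
  have hde : (∏ a', d a') * (∏ b', e b') = 1 := by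
    simp only [hd, he, Finset.prod_ite_eq', Finset.mem_univ, if_true]
    exact mul_inv_cancel₀ two_ne_zero
  have hinv := aeval_eq_of_mem_truncT₀ hG _ (linSubst_torus_detFormLex d e hde)
  rw [stabSubst_diagonal] at hinv
  have hprod := prod_pow_eq_one_of_aeval_smul_X_eq hinv hn
  -- evaluate the character on the monomial
  have hsplit : (n.prod fun p k => (d (ofLex p.2).1 * e (ofLex p.2).2) ^ k) =
      (2 : ℂ) ^ rowDeg a n * (2⁻¹ : ℂ) ^ colDeg b n := by
    rw [Finsupp.prod]
    simp only [mul_pow, Finset.prod_mul_distrib]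
    congr 1
    · rw [rowDeg, ← Finset.prod_pow_eq_pow_sum, Finset.prod_filter]
      refine Finset.prod_congr rfl fun p _ => ?_
      simp only [hd, rowOfVar]
      split_ifs <;> simp
    · rw [colDeg, ← Finset.prod_pow_eq_pow_sum, Finset.prod_filter]
      refine Finset.prod_congr rfl fun p _ => ?_
      simp only [he, colOfVar]
      split_ifs <;> simp
  rw [hsplit] at hprod
  have h2 : (2 : ℂ) ^ rowDeg a n = (2 : ℂ) ^ colDeg b n := by
    have := congrArg (· * (2 : ℂ) ^ colDeg b n) hprod
    simp only [one_mul, mul_assoc, ← mul_pow, inv_mul_cancel₀ (two_ne_zero (α := ℂ)), one_pow, mul_one] at this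
    exact this
  have h3 : ((2 ^ rowDeg a n : ℕ) : ℂ) = ((2 ^ colDeg b n : ℕ) : ℂ) := by simpa using h2
  exact Nat.pow_right_injective le_rfl (Nat.cast_injective h3)

/-- The row-group degrees of a monomial add up to its degree. -/
theorem sum_rowDeg (n : MatIdx m × MatIdx m →₀ ℕ) : ∑ a, rowDeg a n = n.degree := by
  rw [Finsupp.degree_apply]
  exact Finset.sum_fiberwise n.support rowOfVar (fun p => n p)

/-- **Magic-square multidegrees, II**: for `G ∈ T₀` (degree `mδ`) every monomial has degree
exactly `δ` in every row-group and every column-group. -/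
theorem rowDeg_eq_and_colDeg_eq_of_mem_truncT₀ [NeZero m] {δ : ℕ} {χ : Weight (MatIdx m)}
    {G : MvPolynomial (MatIdx m × MatIdx m) ℂ} (hG : G ∈ truncT₀ m δ χ)
    {n : MatIdx m × MatIdx m →₀ ℕ} (hn : n ∈ G.support) (a b : Fin m) :
    rowDeg a n = δ ∧ colDeg b n = δ := by
  have hrow : ∀ a', rowDeg a' n = rowDeg a n := fun a' =>
    (rowDeg_eq_colDeg_of_mem_truncT₀ hG hn a' 0).trans (rowDeg_eq_colDeg_of_mem_truncT₀ hG hn a 0).symm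
  have hdeg : n.degree = m * δ := by
    have := isHomogeneous_of_mem_truncT₀ hG (MvPolynomial.mem_support_iff.mp hn)
    rw [Finsupp.degree_eq_weight_one]
    exact this
  have hsum := sum_rowDeg n
  rw [Finset.sum_congr rfl fun a' _ => hrow a', Finset.sum_const, Finset.card_univ, Fintype.card_fin,
    smul_eq_mul, hdeg] at hsum
  have hra : rowDeg a n = δ := Nat.eq_of_mul_eq_mul_left (NeZero.pos m) hsum
  exact ⟨hra, (rowDeg_eq_colDeg_of_mem_truncT₀ hG hn a b).symm.trans hra⟩

/-- **Block inequality**: a magic square with margins `δ` has mass `≥ (|S|+|T|-m)δ` on `S × T`. -/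
theorem le_blockDeg (S T : Finset (Fin m)) {δ : ℕ} {n : MatIdx m × MatIdx m →₀ ℕ}
    (hrow : ∀ a, rowDeg a n = δ) (hcol : ∀ b, colDeg b n = δ) :
    (S.card + T.card - m) * δ ≤ blockDeg S T n := by
  classical
  -- ∑_{a ∈ S} rowDeg a = mass on rows S = block + (rows S, cols ∉ T) ≤ block + ∑_{b ∉ T} colDeg b
  have h1 : ∑ a ∈ S, rowDeg a n = ∑ p ∈ n.support with rowOfVar p ∈ S, n p :=
    Finset.sum_fiberwise_eq_sum_filter n.support S rowOfVar (fun p => n p)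
  have h2 : ∑ p ∈ n.support with rowOfVar p ∈ S, n p =
      blockDeg S T n + ∑ p ∈ (n.support.filter fun p => rowOfVar p ∈ S) with ¬ colOfVar p ∈ T, n p := by
    rw [blockDeg, ← Finset.sum_filter_add_sum_filter_not (n.support.filter fun p => rowOfVar p ∈ S)
      (fun p => colOfVar p ∈ T) (fun p => n p), Finset.filter_filter]
  have h3 : ∑ p ∈ (n.support.filter fun p => rowOfVar p ∈ S) with ¬ colOfVar p ∈ T, n p ≤
      ∑ p ∈ n.support with colOfVar p ∈ Tᶜ, n p := by
    refine Finset.sum_le_sum_of_subset fun p hp => ?_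
    simp only [Finset.mem_filter, Finset.mem_compl] at hp ⊢
    exact ⟨hp.1.1, hp.2⟩
  have h4 : ∑ p ∈ n.support with colOfVar p ∈ Tᶜ, n p = ∑ b ∈ Tᶜ, colDeg b n :=
    (Finset.sum_fiberwise_eq_sum_filter n.support Tᶜ colOfVar (fun p => n p)).symm
  have h5 : ∑ b ∈ Tᶜ, colDeg b n = (m - T.card) * δ := by
    rw [Finset.sum_congr rfl fun b _ => hcol b, Finset.sum_const, Finset.card_compl, Fintype.card_fin,
      smul_eq_mul]
  have h6 : ∑ a ∈ S, rowDeg a n = S.card * δ := by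
    rw [Finset.sum_congr rfl fun a _ => hrow a, Finset.sum_const, smul_eq_mul]
  have hT : T.card ≤ m := by simpa using T.card_le_univ
  have key : S.card * δ ≤ blockDeg S T n + (m - T.card) * δ := by
    rw [← h6, h1, h2, ← h5, ← h4]
    exact Nat.add_le_add_left h3 _
  have : (S.card + T.card - m) * δ = S.card * δ - (m - T.card) * δ := by
    rw [← Nat.sub_mul]
    congr 1
    omega
  rw [this]
  omega

/-- The ideal generated by the block variables `X_(j,(a,b))`, `a ∈ S`, `b ∈ T`. -/
def blockIdeal (S T : Finset (Fin m)) : Ideal (MvPolynomial (MatIdx m × MatIdx m) ℂ) :=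
  Ideal.span ((fun p => X p) '' {p : MatIdx m × MatIdx m | rowOfVar p ∈ S ∧ colOfVar p ∈ T})

/-- Products of powers of elements of `J` lie in the corresponding power of `J`. -/
theorem prod_pow_mem_pow_sum {R : Type*} [CommSemiring R] {ι : Type*} (J : Ideal R) (s : Finset ι)
    (x : ι → R) (k : ι → ℕ) (hx : ∀ i ∈ s, x i ∈ J) : ∏ i ∈ s, x i ^ k i ∈ J ^ ∑ i ∈ s, k i := by
  classical
  induction s using Finset.induction_on with
  | empty => simp
  | insert i s hi ih =>
    rw [Finset.prod_insert hi, Finset.sum_insert hi, pow_add]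
    exact Ideal.mul_mem_mul (Ideal.pow_mem_pow (hx i (Finset.mem_insert_self i s)) _)
      (ih fun j hj => hx j (Finset.mem_insert_of_mem hj))

/-- A monomial lies in the `blockDeg`-th power of the block ideal. -/
theorem monomial_mem_blockIdeal_pow (S T : Finset (Fin m)) (n : MatIdx m × MatIdx m →₀ ℕ) (c : ℂ) :
    (monomial n c : MvPolynomial (MatIdx m × MatIdx m) ℂ) ∈ blockIdeal S T ^ blockDeg S T n := by
  classical
  rw [MvPolynomial.monomial_eq, Finsupp.prod, ← Finset.prod_filter_mul_prod_filter_not n.support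
    (fun p => rowOfVar p ∈ S ∧ colOfVar p ∈ T)]
  refine Ideal.mul_mem_left _ _ (Ideal.mul_mem_right _ _ ?_)
  refine prod_pow_mem_pow_sum (blockIdeal S T) _ (fun p => X p) (fun p => n p) fun p hp => ?_
  refine Ideal.subset_span ⟨p, ?_, rfl⟩
  exact (Finset.mem_filter.mp hp).2

/-- The coordinate compression space with zero block `S × T`. -/
def blockSpace (S T : Finset (Fin m)) : Submodule ℂ (MatIdx m → ℂ) where
  carrier := {u | ∀ a ∈ S, ∀ b ∈ T, u (toLex (a, b)) = 0}
  add_mem' {u v} hu hv a ha b hb := by simp [hu a ha b hb, hv a ha b hb]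
  zero_mem' a _ b _ := rfl
  smul_mem' c {u} hu a ha b hb := by simp [hu a ha b hb]

/-- The block variables vanish on `L_U` when `U` lies in the compression space. -/
theorem blockIdeal_le_vanishingIdeal (S T : Finset (Fin m)) {U : Submodule ℂ (MatIdx m → ℂ)}
    (hU : U ≤ blockSpace S T) :
    blockIdeal S T ≤ MvPolynomial.vanishingIdeal ℂ
      {p : MatIdx m × MatIdx m → ℂ | ∀ j : MatIdx m, (fun i => p (j, i)) ∈ U} := by
  rw [blockIdeal, Ideal.span_le]
  rintro _ ⟨q, hq, rfl⟩ x hx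
  rw [MvPolynomial.aeval_X]
  have hxq := hU (hx q.1) (ofLex q.2).1 hq.1 (ofLex q.2).2 hq.2
  simpa using hxq

/-- **The cut is invisible on coordinate compression spaces** (ideal form).  If
`U ≤ blockSpace S T` with `|S| + |T| ≥ m + (m - r)`, then every element of `T₀` satisfies the
valuative condition `G ∈ I(L_U)^{δ(m-r)}`.  (For `r ≥ m` this is `truncT_of_le`; the content is
`r < m`.)  Submodule form: `truncT_eq_truncT₀_of_le_blockSpace`; consequently a `ValuativeFlip`
witness with such a `U` is already a symmetric-Kronecker (`U = ⊥`) witness. -/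
theorem mem_pow_vanishingIdeal_of_mem_truncT₀ [NeZero m] (S T : Finset (Fin m)) {r : ℕ}
    (hr : m + (m - r) ≤ S.card + T.card) {U : Submodule ℂ (MatIdx m → ℂ)} (hU : U ≤ blockSpace S T)
    {δ : ℕ} {χ : Weight (MatIdx m)} {G : MvPolynomial (MatIdx m × MatIdx m) ℂ} (hG : G ∈ truncT₀ m δ χ) :
    G ∈ (MvPolynomial.vanishingIdeal ℂ
      {p : MatIdx m × MatIdx m → ℂ | ∀ j : MatIdx m, (fun i => p (j, i)) ∈ U}) ^ (δ * (m - r)) := by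
  classical
  rw [MvPolynomial.as_sum G]
  refine Ideal.sum_mem _ fun n hn => ?_
  have hmagic := fun a b => rowDeg_eq_and_colDeg_eq_of_mem_truncT₀ hG hn a b
  have hblock : δ * (m - r) ≤ blockDeg S T n := by
    have h1 := le_blockDeg S T (n := n) (δ := δ) (fun a => (hmagic a 0).1) (fun b => (hmagic 0 b).2)
    have h2 : m - r ≤ S.card + T.card - m := by omega
    calc δ * (m - r) ≤ δ * (S.card + T.card - m) := Nat.mul_le_mul_left δ h2
      _ = (S.card + T.card - m) * δ := mul_comm _ _
      _ ≤ blockDeg S T n := h1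
  exact Ideal.pow_right_mono (blockIdeal_le_vanishingIdeal S T hU) _
    (Ideal.pow_le_pow_right hblock (monomial_mem_blockIdeal_pow S T n _))

/-- **The cut is invisible on coordinate compression spaces**: `T_U = T₀` for
`U ≤ blockSpace S T`, `|S| + |T| ≥ m + (m - r)`. -/
theorem truncT_eq_truncT₀_of_le_blockSpace [NeZero m] (S T : Finset (Fin m)) {r : ℕ}
    (hr : m + (m - r) ≤ S.card + T.card) {U : Submodule ℂ (MatIdx m → ℂ)} (hU : U ≤ blockSpace S T)
    (δ : ℕ) (χ : Weight (MatIdx m)) : truncT m U r δ χ = truncT₀ m δ χ :=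
  truncT_eq_truncT₀_of_forall fun _ hG =>
    (Submodule.restrictScalars_mem ℂ _ _).mpr (mem_pow_vanishingIdeal_of_mem_truncT₀ S T hr hU hG)

/-- **Corollary (matrices with a common zero row never cut).**  `U = ` the matrices whose row
`a₀` vanishes (rank `≤ m-1`, dimension `m(m-1)`, a maximal singular space in the null cone):
`T_U = T₀` for `r = m - 1`. -/
theorem truncT_zeroRow [NeZero m] (a₀ : Fin m) (δ : ℕ) (χ : Weight (MatIdx m)) :
    truncT m (blockSpace {a₀} Finset.univ) (m - 1) δ χ = truncT₀ m δ χ :=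
  truncT_eq_truncT₀_of_le_blockSpace {a₀} Finset.univ
    (by rw [Finset.card_singleton, Finset.card_univ, Fintype.card_fin]; omega) le_rfl δ χ

/-- **Corollary (matrices with a common zero column never cut).** -/
theorem truncT_zeroCol [NeZero m] (b₀ : Fin m) (δ : ℕ) (χ : Weight (MatIdx m)) :
    truncT m (blockSpace Finset.univ {b₀}) (m - 1) δ χ = truncT₀ m δ χ :=
  truncT_eq_truncT₀_of_le_blockSpace Finset.univ {b₀}
    (by rw [Finset.card_singleton, Finset.card_univ, Fintype.card_fin]; omega) le_rfl δ χ

/-! ### Transport along the stabiliser: the cut only sees the `Stab(det_m)`-orbit of `U` -/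

/-- The point map `A ↦ A·M₀` on `End`, in coordinates: `(A·M₀)_(j,i) = Σ_l M₀ l i · A_(j,l)`. -/
def rightMulPt (M₀ : Matrix (MatIdx m) (MatIdx m) ℂ) (A : MatIdx m × MatIdx m → ℂ) :
    MatIdx m × MatIdx m → ℂ :=
  fun p => ∑ l : MatIdx m, M₀ l p.2 * A (p.1, l)

/-- Evaluation after the stabiliser substitution `σ_{M₀}` is evaluation at `A·M₀`. -/
theorem aeval_stabSubst (M₀ : Matrix (MatIdx m) (MatIdx m) ℂ) (A : MatIdx m × MatIdx m → ℂ)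
    (F : MvPolynomial (MatIdx m × MatIdx m) ℂ) :
    MvPolynomial.aeval A (MvPolynomial.aeval (R := ℂ)
      (fun p : MatIdx m × MatIdx m => ∑ l : MatIdx m,
        M₀ l p.2 • (MvPolynomial.X (p.1, l) : MvPolynomial (MatIdx m × MatIdx m) ℂ)) F) =
      MvPolynomial.aeval (rightMulPt M₀ A) F := by
  have hfun : (fun p : MatIdx m × MatIdx m => MvPolynomial.aeval A (∑ l : MatIdx m,
      M₀ l p.2 • (MvPolynomial.X (p.1, l) : MvPolynomial (MatIdx m × MatIdx m) ℂ))) = rightMulPt M₀ A := by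
    funext p
    simp only [map_sum, map_smul, MvPolynomial.aeval_X, smul_eq_mul, rightMulPt]
  rw [MvPolynomial.comp_aeval_apply, hfun]

/-- `σ_{M₀}` maps `I(L₂)` into `I(L₁)` whenever `·M₀` maps `L₁` into `L₂`. -/
theorem map_stabSubst_vanishingIdeal_le (M₀ : Matrix (MatIdx m) (MatIdx m) ℂ)
    {L₁ L₂ : Set (MatIdx m × MatIdx m → ℂ)} (h : ∀ A ∈ L₁, rightMulPt M₀ A ∈ L₂) :
    Ideal.map (MvPolynomial.aeval (R := ℂ)
      (fun p : MatIdx m × MatIdx m => ∑ l : MatIdx m,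
        M₀ l p.2 • (MvPolynomial.X (p.1, l) : MvPolynomial (MatIdx m × MatIdx m) ℂ)))
      (MvPolynomial.vanishingIdeal ℂ L₂) ≤ MvPolynomial.vanishingIdeal ℂ L₁ := by
  rw [Ideal.map_le_iff_le_comap]
  intro F hF
  rw [Ideal.mem_comap, MvPolynomial.mem_vanishingIdeal_iff]
  intro A hA
  rw [MvPolynomial.mem_vanishingIdeal_iff] at hF
  have := hF (rightMulPt M₀ A) (h A hA)
  rw [← aeval_stabSubst] at this
  exact this

/-- **Transport.**  If an `End`-stabiliser element `M₀` of `det_m` moves the rows of `U` into a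
space `U₂` inside a coordinate compression space of the right size, then `T_U = T₀`: for
`G ∈ T₀`, `G = σ_{M₀} G ∈ σ_{M₀}(I(L_{U₂})^t) ⊆ I(L_U)^t`.  Since every compression space
`{u | u V ⊆ V'}` (`dim V - dim V' ≥ m - r`) is moved into a `blockSpace` by some
`M₀ = kronLex P Q` (`u ↦ P u Q`, `det P det Q = 1`, `linSubst_kronLex_detFormLex`), the valuative
cut is invisible on the whole null cone of the left-right action (spaces of nc-rank `≤ r`). -/
theorem truncT_eq_truncT₀_of_stab_transport [NeZero m] (S T : Finset (Fin m)) {r : ℕ}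
    (hr : m + (m - r) ≤ S.card + T.card) (M₀ : Matrix (MatIdx m) (MatIdx m) ℂ)
    (hM₀ : linSubst (MatIdx m) ℂ M₀ (detFormLex ℂ m) = detFormLex ℂ m)
    {U U₂ : Submodule ℂ (MatIdx m → ℂ)} (hU₂ : U₂ ≤ blockSpace S T)
    (hU : ∀ u ∈ U, (fun i => ∑ l : MatIdx m, M₀ l i * u l) ∈ U₂) (δ : ℕ) (χ : Weight (MatIdx m)) :
    truncT m U r δ χ = truncT₀ m δ χ := by
  refine truncT_eq_truncT₀_of_forall fun G hG => ?_
  rw [Submodule.restrictScalars_mem]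
  have h2 := mem_pow_vanishingIdeal_of_mem_truncT₀ S T hr hU₂ hG
  have hfix := aeval_eq_of_mem_truncT₀ hG M₀ hM₀
  rw [← hfix]
  have hmem := Ideal.mem_map_of_mem (MvPolynomial.aeval (R := ℂ)
    (fun p : MatIdx m × MatIdx m => ∑ l : MatIdx m,
      M₀ l p.2 • (MvPolynomial.X (p.1, l) : MvPolynomial (MatIdx m × MatIdx m) ℂ))) h2
  rw [Ideal.map_pow] at hmem
  have hpts : ∀ A ∈ {p : MatIdx m × MatIdx m → ℂ | ∀ j : MatIdx m, (fun i => p (j, i)) ∈ U},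
      rightMulPt M₀ A ∈ {p : MatIdx m × MatIdx m → ℂ | ∀ j : MatIdx m, (fun i => p (j, i)) ∈ U₂} := by
    intro A hA
    simp only [Set.mem_setOf_eq] at hA ⊢
    intro j
    exact hU _ (hA j)
  exact Ideal.pow_right_mono (map_stabSubst_vanishingIdeal_le M₀ hpts) _ hmem

/-- The Kronecker substitution `x_{ab} ↦ Σ_{cd} P a c · Q d b · x_{cd}` (i.e. `X ↦ P X Q`), as a
matrix on the lexicographic variables: `M_{(c,d),(a,b)} = P a c · Q d b`. -/
def kronLex (P Q : Matrix (Fin m) (Fin m) ℂ) : Matrix (MatIdx m) (MatIdx m) ℂ :=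
  Matrix.of fun i j => P (ofLex j).1 (ofLex i).1 * Q (ofLex i).2 (ofLex j).2

/-- Sums over `MatIdx m` are double sums over rows and columns. -/
theorem sum_matIdx {M : Type*} [AddCommMonoid M] (f : MatIdx m → M) :
    ∑ i : MatIdx m, f i = ∑ c : Fin m, ∑ d : Fin m, f (toLex (c, d)) := by
  rw [← Fintype.sum_prod_type (fun cd : Fin m × Fin m => f (toLex cd))]
  exact (Fintype.sum_equiv toLex (fun cd => f (toLex cd)) f fun _ => rfl).symm

/-- **`X ↦ P X Q` multiplies `det_m` by `det P · det Q`** (Frobenius' stabiliser). -/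
theorem linSubst_kronLex_detFormLex (P Q : Matrix (Fin m) (Fin m) ℂ) :
    linSubst (MatIdx m) ℂ (kronLex P Q) (detFormLex ℂ m) = C (P.det * Q.det) * detFormLex ℂ m := by
  rw [detFormLex_eq_det, AlgHom.map_det]
  have hmap : (linSubst (MatIdx m) ℂ (kronLex P Q)).mapMatrix (lexVarMatrix m) =
      P.map C * lexVarMatrix m * Q.map C := by
    refine Matrix.ext fun a b => ?_
    rw [AlgHom.mapMatrix_apply, Matrix.map_apply, lexVarMatrix, Matrix.of_apply, linSubst_X,
      sum_matIdx (fun j : MatIdx m => kronLex P Q j (toLex (a, b)) • (X j : MvPolynomial (MatIdx m) ℂ)),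
      Matrix.mul_apply]
    conv_lhs => rw [Finset.sum_comm]
    refine Finset.sum_congr rfl fun d _ => ?_
    rw [Matrix.mul_apply, Finset.sum_mul]
    refine Finset.sum_congr rfl fun c _ => ?_
    simp only [kronLex, Matrix.of_apply, ofLex_toLex, Matrix.map_apply, smul_eq_C_mul, map_mul]
    ring
  rw [hmap, Matrix.det_mul, Matrix.det_mul]
  have hP : (P.map C : Matrix (Fin m) (Fin m) (MvPolynomial (MatIdx m) ℂ)).det = C P.det := by
    rw [RingHom.map_det, RingHom.mapMatrix_apply]
  have hQ : (Q.map C : Matrix (Fin m) (Fin m) (MvPolynomial (MatIdx m) ℂ)).det = C Q.det := by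
    rw [RingHom.map_det, RingHom.mapMatrix_apply]
  rw [hP, hQ, map_mul]
  ring

/-- `kronLex P Q` stabilises `det_m` when `det P · det Q = 1`. -/
theorem linSubst_kronLex_detFormLex_of_det (P Q : Matrix (Fin m) (Fin m) ℂ) (h : P.det * Q.det = 1) :
    linSubst (MatIdx m) ℂ (kronLex P Q) (detFormLex ℂ m) = detFormLex ℂ m := by
  rw [linSubst_kronLex_detFormLex, h, map_one, one_mul]

/-- The row transform of `kronLex P Q` is `u ↦ P u Q` on `m × m` matrices. -/
theorem kronLex_row (P Q : Matrix (Fin m) (Fin m) ℂ) (u : MatIdx m → ℂ) (a b : Fin m) :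
    ∑ l : MatIdx m, kronLex P Q l (toLex (a, b)) * u l =
      (P * Matrix.of (fun c d => u (toLex (c, d))) * Q) a b := by
  rw [sum_matIdx (fun l : MatIdx m => kronLex P Q l (toLex (a, b)) * u l), Matrix.mul_apply]
  conv_lhs => rw [Finset.sum_comm]
  refine Finset.sum_congr rfl fun d _ => ?_
  rw [Matrix.mul_apply, Finset.sum_mul]
  refine Finset.sum_congr rfl fun c _ => ?_
  simp only [kronLex, Matrix.of_apply, ofLex_toLex]
  ring

/-- **The cut is invisible on every space equivalent to a compression space**: if `det P det Q = 1`
and `P u Q` has zero block `S × T` (`|S|+|T| ≥ m + (m-r)`) for every `u ∈ U`, then `T_U = T₀`. -/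
theorem truncT_eq_truncT₀_of_equiv_compression [NeZero m] (S T : Finset (Fin m)) {r : ℕ}
    (hr : m + (m - r) ≤ S.card + T.card) (P Q : Matrix (Fin m) (Fin m) ℂ) (hPQ : P.det * Q.det = 1)
    {U : Submodule ℂ (MatIdx m → ℂ)}
    (hU : ∀ u ∈ U, ∀ a ∈ S, ∀ b ∈ T, (P * Matrix.of (fun c d => u (toLex (c, d))) * Q) a b = 0)
    (δ : ℕ) (χ : Weight (MatIdx m)) : truncT m U r δ χ = truncT₀ m δ χ := by
  refine truncT_eq_truncT₀_of_stab_transport S T hr (kronLex P Q)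
    (linSubst_kronLex_detFormLex_of_det P Q hPQ) (U₂ := blockSpace S T) le_rfl (fun u hu a ha b hb => ?_) δ χ
  change ∑ l : MatIdx m, kronLex P Q l (toLex (a, b)) * u l = 0
  rw [kronLex_row]
  exact hU u hu a ha b hb

end NullCone


/-! ## Redundancy: the homogeneity clause is implied by the Borel clause (F4, mutation)

The scalar matrix `2 • 1` is upper triangular; semi-invariance under it reads
`G(2⁻¹ A) = 2^{size χ} G(A)`, which pins the degree of every monomial of `G` to `-size χ`.
For the crux weight `χ = λ*` (`λ ⊢ mδ`, `≤ m²` parts) `size χ = -mδ`, so the factor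
`homogeneousSubmodule (m*δ)` of `T` is implied by the Borel factor: a prover of `ValuativeBound`
need not check homogeneity separately, and the mutation "drop homogeneity" changes nothing. -/

section Redundancy

variable {m : ℕ}

/-- The Borel factor of the crux: `B`-semi-invariants of weight `χ` for `G ↦ G(g⁻¹ A)`. -/
def borelPart (m : ℕ) (χ : Weight (MatIdx m)) : Submodule ℂ (MvPolynomial (MatIdx m × MatIdx m) ℂ) :=
  ⨅ (g : Matrix.GeneralLinearGroup (MatIdx m) ℂ) (_ : IsUpperTriangular g),
    LinearMap.ker ((MvPolynomial.aeval (R := ℂ) fun p : MatIdx m × MatIdx m =>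
      ∑ l : MatIdx m, ((g⁻¹ : Matrix.GeneralLinearGroup (MatIdx m) ℂ) :
        Matrix (MatIdx m) (MatIdx m) ℂ) p.1 l • MvPolynomial.X (l, p.2)).toLinearMap -
      weightChar χ g • LinearMap.id (R := ℂ) (M := MvPolynomial (MatIdx m × MatIdx m) ℂ))

/-- The stabiliser factor of the crux (right `End`-stabiliser invariance). -/
def stabPart (m : ℕ) : Submodule ℂ (MvPolynomial (MatIdx m × MatIdx m) ℂ) :=
  ⨅ (M : Matrix (MatIdx m) (MatIdx m) ℂ) (_ : linSubst (MatIdx m) ℂ M (detFormLex ℂ m) = detFormLex ℂ m),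
    LinearMap.ker ((MvPolynomial.aeval (R := ℂ) fun p : MatIdx m × MatIdx m =>
      ∑ l : MatIdx m, M l p.2 • MvPolynomial.X (p.1, l)).toLinearMap -
      LinearMap.id (R := ℂ) (M := MvPolynomial (MatIdx m × MatIdx m) ℂ))

/-- `T` is the intersection of its four named factors (definitional bookkeeping). -/
theorem truncT_eq_inf (U : Submodule ℂ (MatIdx m → ℂ)) (r δ : ℕ) (χ : Weight (MatIdx m)) :
    truncT m U r δ χ = MvPolynomial.homogeneousSubmodule (MatIdx m × MatIdx m) ℂ (m * δ) ⊓
      ((MvPolynomial.vanishingIdeal ℂ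
        {p : MatIdx m × MatIdx m → ℂ | ∀ j : MatIdx m, (fun i => p (j, i)) ∈ U}) ^ (δ * (m - r))).restrictScalars ℂ ⊓
      stabPart m ⊓ borelPart m χ :=
  rfl

/-- `∏ a^{f i} = a^{∑ f i}` for integer exponents (`a ≠ 0`). -/
theorem prod_const_zpow {ι : Type*} (s : Finset ι) (a : ℂ) (ha : a ≠ 0) (f : ι → ℤ) :
    ∏ i ∈ s, a ^ f i = a ^ ∑ i ∈ s, f i := by
  classical
  induction s using Finset.induction_on with
  | empty => simp
  | insert i s hi ih => rw [Finset.prod_insert hi, Finset.sum_insert hi, zpow_add₀ ha, ih]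

/-- **Weight pins degree** for the transported action: an element of the Borel factor of weight
`χ` with `size χ = -d` is homogeneous of degree `d` (test at the scalar matrix `2 • 1`). -/
theorem isHomogeneous_of_mem_borelPart {χ : Weight (MatIdx m)} {d : ℕ} (hχ : χ.size = -(d : ℤ))
    {G : MvPolynomial (MatIdx m × MatIdx m) ℂ} (hG : G ∈ borelPart m χ) : G.IsHomogeneous d := by
  classical
  set g : GL (MatIdx m) ℂ := torusElt (fun _ : MatIdx m => (2 : ℂ)) (fun _ => two_ne_zero) with hg
  have hgD : IsDiagonalGL g := isDiagonalGL_torusElt _ _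
  have hgU : IsUpperTriangular g := hgD.isUpperTriangular
  have hg' : IsDiagonalGL g⁻¹ := (torusSubgroup (MatIdx m) ℂ).inv_mem hgD
  have hginv : ((g⁻¹ : GL (MatIdx m) ℂ) : Matrix (MatIdx m) (MatIdx m) ℂ) =
      Matrix.diagonal fun _ => (2 : ℂ)⁻¹ := by
    rw [coe_eq_diagonal_of_isDiagonalGL hg']
    congr 1
    funext i
    rw [inv_apply_diag_of_isUpperTriangular' hgU i, hg, coe_torusElt, Matrix.diagonal_apply_eq]
  have hsub : (fun p : MatIdx m × MatIdx m => ∑ l : MatIdx m,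
      ((g⁻¹ : GL (MatIdx m) ℂ) : Matrix (MatIdx m) (MatIdx m) ℂ) p.1 l •
        (X (l, p.2) : MvPolynomial (MatIdx m × MatIdx m) ℂ)) = fun p => (fun _ => (2 : ℂ)⁻¹) p • X p := by
    funext p
    rw [hginv, Finset.sum_eq_single p.1 (fun l _ hl => by
      rw [Matrix.diagonal_apply_ne _ (Ne.symm hl), zero_smul]) (fun h => absurd (Finset.mem_univ _) h),
      Matrix.diagonal_apply_eq]
  have hw : weightChar χ g = ((2 : ℂ) ^ d)⁻¹ := by
    rw [hg, weightChar_torusElt, prod_const_zpow _ _ two_ne_zero, ← Weight.size, hχ, zpow_neg, zpow_natCast]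
  simp only [borelPart, Submodule.mem_iInf, LinearMap.mem_ker, LinearMap.sub_apply, LinearMap.smul_apply,
    LinearMap.id_apply, AlgHom.toLinearMap_apply, sub_eq_zero] at hG
  have heq := hG g hgU
  rw [hsub, hw] at heq
  intro n hn
  have hc : MvPolynomial.coeff n G ≠ 0 := hn
  have h1 := congrArg (MvPolynomial.coeff n) heq
  rw [coeff_aeval_smul_X, MvPolynomial.coeff_smul, smul_eq_mul] at h1
  have h2 : (n.prod fun _ k => ((2 : ℂ)⁻¹) ^ k) = ((2 : ℂ)⁻¹) ^ n.degree := by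
    rw [Finsupp.prod, Finset.prod_pow_eq_pow_sum, Finsupp.degree_apply]
  rw [h2, ← inv_pow] at h1
  have h3 : ((2 : ℂ)⁻¹) ^ n.degree = ((2 : ℂ)⁻¹) ^ d := mul_right_cancel₀ hc h1
  have h4 : (2 : ℂ) ^ n.degree = (2 : ℂ) ^ d := by
    rw [inv_pow, inv_pow] at h3
    exact inv_injective h3
  have h5 : ((2 ^ n.degree : ℕ) : ℂ) = ((2 ^ d : ℕ) : ℂ) := by simpa using h4
  have h6 : n.degree = d := Nat.pow_right_injective le_rfl (Nat.cast_injective h5)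
  rw [← h6, Finsupp.degree_eq_weight_one]
  rfl

/-- Size is invariant under transport to `MatIdx`. -/
theorem size_toMatIdx (χ : Weight (Fin (m * m))) : (Weight.toMatIdx χ).size = χ.size := by
  simp only [Weight.size, Weight.toMatIdx]
  exact Fintype.sum_equiv (matIdxEquiv m).symm.toEquiv _ _ fun _ => rfl

/-- The crux weight `λ*` has size `-mδ` (`λ ⊢ mδ` with at most `m²` parts). -/
theorem size_flipWeight {δ : ℕ} {lam : Nat.Partition (m * δ)} (h : lam.parts.card ≤ m * m) :
    (flipWeight m δ lam).size = -((m * δ : ℕ) : ℤ) := by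
  rw [flipWeight, size_toMatIdx, Weight.dualOfPartition, Weight.size_dual, Weight.size_ofPartition_holds h]

/-- **The homogeneity clause of the crux is redundant**: for the crux weight, the Borel factor
already lies in `homogeneousSubmodule (m*δ)`. -/
theorem borelPart_le_homogeneousSubmodule {δ : ℕ} {lam : Nat.Partition (m * δ)}
    (h : lam.parts.card ≤ m * m) :
    borelPart m (flipWeight m δ lam) ≤ MvPolynomial.homogeneousSubmodule (MatIdx m × MatIdx m) ℂ (m * δ) :=
  fun _ hG => (MvPolynomial.mem_homogeneousSubmodule _ _).mpr
    (isHomogeneous_of_mem_borelPart (size_flipWeight h) hG)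

/-- The truncation with the homogeneity factor dropped equals the truncation (crux weight). -/
theorem truncT_eq_dropHomogeneous (U : Submodule ℂ (MatIdx m → ℂ)) (r : ℕ) {δ : ℕ}
    {lam : Nat.Partition (m * δ)} (h : lam.parts.card ≤ m * m) :
    truncT m U r δ (flipWeight m δ lam) =
      ((MvPolynomial.vanishingIdeal ℂ
        {p : MatIdx m × MatIdx m → ℂ | ∀ j : MatIdx m, (fun i => p (j, i)) ∈ U}) ^ (δ * (m - r))).restrictScalars ℂ ⊓
      stabPart m ⊓ borelPart m (flipWeight m δ lam) := by
  rw [truncT_eq_inf]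
  refine le_antisymm (fun G hG => ?_) (fun G hG => ?_)
  · simp only [Submodule.mem_inf] at hG ⊢
    exact ⟨⟨hG.1.1.2, hG.1.2⟩, hG.2⟩
  · simp only [Submodule.mem_inf] at hG ⊢
    exact ⟨⟨⟨borelPart_le_homogeneousSubmodule h hG.2, hG.1.1⟩, hG.1.2⟩, hG.2⟩

end Redundancy


/-! ## The degenerate size `m = 1`: no witness, so `n ≤ m` and `∃ n₀` are load-bearing (F4)

At `m = 1` the padded permanent is `det₁ = x` (for every `n`), `T` is the line spanned by
`X^δ` and every multiplicity of `ℂ[Δ(x)] = ℂ[y]` is `≤ 1`; hence `FlipBody n 1` fails for every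
`n`.  Consequently the variants of the crux WITHOUT the window's lower bound `n ≤ m`, or WITHOUT
the eventuality `∃ n₀` (then `n = m = 1` is forced at `c = 1`), are FALSE. -/

section MOne

/-- The unique lexicographic index at `m = 1`. -/
def i₁ : MatIdx 1 := toLex ((0 : Fin 1), (0 : Fin 1))

theorem eq_i₁ (i : MatIdx 1) : i = i₁ := by
  rcases h : ofLex i with ⟨a, b⟩
  have hi : i = toLex (a, b) := by rw [← h, toLex_ofLex]
  rw [hi, i₁, Subsingleton.elim a 0, Subsingleton.elim b 0]

/-- At `m = 1` the rank bound with `r = 0` forces `U = ⊥`. -/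
theorem eq_bot_of_rankLE_one_zero {U : Submodule ℂ (MatIdx 1 → ℂ)} (hU : RankLE 1 U 0) : U = ⊥ := by
  rw [Submodule.eq_bot_iff]
  intro u hu
  have hr := hU u hu
  by_contra hne
  have hu0 : u i₁ ≠ 0 := by
    intro h0
    apply hne
    funext i
    rw [eq_i₁ i, h0]
    rfl
  set M : Matrix (Fin 1) (Fin 1) ℂ := Matrix.of fun a b : Fin 1 => u (toLex (a, b)) with hM
  have hdet : IsUnit M := by
    rw [Matrix.isUnit_iff_isUnit_det, Matrix.det_fin_one, hM, Matrix.of_apply]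
    exact isUnit_iff_ne_zero.mpr hu0
  have hrank := Matrix.rank_of_isUnit M hdet
  rw [Fintype.card_fin] at hrank
  rw [hrank] at hr
  exact Nat.not_succ_le_zero 0 hr

/-- At `m = 1` no admissible `(U, r)` cuts: `T_U = T₀`. -/
theorem truncT_one_eq (U : Submodule ℂ (MatIdx 1 → ℂ)) (r : ℕ) (hU : RankLE 1 U r) (δ : ℕ)
    (χ : Weight (MatIdx 1)) : truncT 1 U r δ χ = truncT₀ 1 δ χ := by
  rcases Nat.eq_zero_or_pos r with rfl | hr
  · rw [eq_bot_of_rankLE_one_zero hU]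
    exact truncT_bot_zero 1 δ χ
  · exact truncT_of_le hr U δ χ

/-- `det₁ = x` in the lexicographic variable. -/
theorem detFormLex_one : detFormLex ℂ 1 = X i₁ := by
  rw [detFormLex_eq_det, Matrix.det_fin_one, lexVarMatrix, Matrix.of_apply]
  rfl

/-- The `End`-stabiliser of `det₁ = x` is trivial: `M i₁ i₁ = 1`. -/
theorem stab_one {M : Matrix (MatIdx 1) (MatIdx 1) ℂ}
    (hM : linSubst (MatIdx 1) ℂ M (detFormLex ℂ 1) = detFormLex ℂ 1) : M i₁ i₁ = 1 := by
  rw [detFormLex_one, linSubst_X, Finset.sum_eq_single i₁ (fun j _ hj => absurd (eq_i₁ j) hj)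
    (fun h => absurd (Finset.mem_univ _) h)] at hM
  have := congrArg (MvPolynomial.coeff (Finsupp.single i₁ 1)) hM
  simpa [MvPolynomial.coeff_smul] using this

/-- The largest part of `λ ⊢ 1·δ` with at most one part is `δ`. -/
theorem getD_sortedParts_of_card_le_one {δ : ℕ} (lam : Nat.Partition (1 * δ)) (h : lam.parts.card ≤ 1 * 1) :
    lam.sortedParts.getD 0 0 = δ := by
  have hlen : lam.sortedParts.length ≤ 1 := by rw [Nat.Partition.length_sortedParts]; simpa using h
  have hsum : lam.sortedParts.sum = δ := by rw [Nat.Partition.sum_sortedParts, one_mul]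
  match hl : lam.sortedParts, hlen, hsum with
  | [], _, hs => simpa using hs
  | [a], _, hs => simpa using hs
  | a :: b :: t, hl2, _ => simp at hl2

/-- The crux weight at `m = 1` is `-δ` at the unique index. -/
theorem flipWeight_one {δ : ℕ} (lam : Nat.Partition (1 * δ)) (h : lam.parts.card ≤ 1 * 1) :
    flipWeight 1 δ lam i₁ = -(δ : ℤ) := by
  simp only [flipWeight, Weight.toMatIdx, Weight.dualOfPartition, Weight.dual, Weight.ofPartition]
  set e := (matIdxEquiv 1).symm i₁ with he
  have hrev : ((Fin.rev e : Fin (1 * 1)) : ℕ) = 0 := by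
    have := (Fin.rev e).2
    omega
  rw [hrev, getD_sortedParts_of_card_le_one lam h]

/-- **`X^δ ∈ T` at `m = 1`** for every admissible `(U, r, λ)`. -/
theorem X_pow_mem_truncT_one (U : Submodule ℂ (MatIdx 1 → ℂ)) (r : ℕ) (hU : RankLE 1 U r) (δ : ℕ)
    (lam : Nat.Partition (1 * δ)) (h : lam.parts.card ≤ 1 * 1) :
    (X (i₁, i₁) : MvPolynomial (MatIdx 1 × MatIdx 1) ℂ) ^ δ ∈ truncT 1 U r δ (flipWeight 1 δ lam) := by
  rw [truncT_one_eq U r hU]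
  simp only [truncT₀, Submodule.mem_inf, Submodule.mem_iInf, LinearMap.mem_ker, LinearMap.sub_apply,
    LinearMap.smul_apply, LinearMap.id_apply, AlgHom.toLinearMap_apply, sub_eq_zero]
  refine ⟨⟨?_, fun M hM => ?_⟩, fun g hg => ?_⟩
  · rw [MvPolynomial.mem_homogeneousSubmodule, one_mul]
    exact MvPolynomial.isHomogeneous_X_pow _ δ
  · have h1 : (fun p : MatIdx 1 × MatIdx 1 => ∑ l : MatIdx 1, M l p.2 • (X (p.1, l) : MvPolynomial (MatIdx 1 × MatIdx 1) ℂ)) =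
        fun p => X p := by
      funext p
      obtain ⟨p1, p2⟩ := p
      obtain rfl : p1 = i₁ := eq_i₁ p1
      obtain rfl : p2 = i₁ := eq_i₁ p2
      rw [Finset.sum_eq_single i₁ (fun j _ hj => absurd (eq_i₁ j) hj) (fun h => absurd (Finset.mem_univ _) h),
        stab_one hM, one_smul]
    rw [h1, MvPolynomial.aeval_X_left_apply]
  · have hginv := inv_apply_diag_of_isUpperTriangular' hg i₁
    have h1 : (fun p : MatIdx 1 × MatIdx 1 => ∑ l : MatIdx 1,
        ((g⁻¹ : GL (MatIdx 1) ℂ) : Matrix (MatIdx 1) (MatIdx 1) ℂ) p.1 l • (X (l, p.2) : MvPolynomial (MatIdx 1 × MatIdx 1) ℂ)) =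
        fun p => (fun _ => ((g : Matrix (MatIdx 1) (MatIdx 1) ℂ) i₁ i₁)⁻¹) p • X p := by
      funext p
      obtain ⟨p1, p2⟩ := p
      obtain rfl : p1 = i₁ := eq_i₁ p1
      obtain rfl : p2 = i₁ := eq_i₁ p2
      rw [Finset.sum_eq_single i₁ (fun j _ hj => absurd (eq_i₁ j) hj) (fun h => absurd (Finset.mem_univ _) h),
        hginv]
    rw [h1, map_pow, MvPolynomial.aeval_X, smul_pow, weightChar,
      Finset.prod_eq_single i₁ (fun j _ hj => absurd (eq_i₁ j) hj) (fun h => absurd (Finset.mem_univ _) h),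
      flipWeight_one lam h, zpow_neg, zpow_natCast, inv_pow]

/-- Hence `finrank T ≥ 1` at `m = 1`. -/
theorem one_le_finrank_truncT_one (U : Submodule ℂ (MatIdx 1 → ℂ)) (r : ℕ) (hU : RankLE 1 U r) (δ : ℕ)
    (lam : Nat.Partition (1 * δ)) (h : lam.parts.card ≤ 1 * 1) :
    1 ≤ Module.finrank ℂ ↥(truncT 1 U r δ (flipWeight 1 δ lam)) := by
  haveI : Module.Finite ℂ (MvPolynomial.homogeneousSubmodule (MatIdx 1 × MatIdx 1) ℂ (1 * δ)) :=
    finite_homogeneousSubmodule _ ℂ _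
  haveI : Module.Finite ℂ ↥(truncT 1 U r δ (flipWeight 1 δ lam)) :=
    Submodule.finiteDimensional_of_le ((truncT_le_truncT₀ 1 U r δ _).trans fun G hG => by
      simp only [truncT₀, Submodule.mem_inf] at hG
      exact hG.1.1)
  rw [Submodule.one_le_finrank_iff]
  intro hbot
  have hmem := X_pow_mem_truncT_one U r hU δ lam h
  rw [hbot, Submodule.mem_bot] at hmem
  exact pow_ne_zero δ (MvPolynomial.X_ne_zero _) hmem

/-- The unique degree-`1` monomial index at `m = 1`. -/
theorem degIdx_one_apply (d : DegIdx (MatIdx 1) 1) : d.1 i₁ = 1 := by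
  have hd := mem_degMonomials_iff.mp d.2
  rw [Finsupp.degree_eq_sum, Finset.sum_eq_single i₁ (fun j _ hj => absurd (eq_i₁ j) hj)
    (fun h => absurd (Finset.mem_univ _) h)] at hd
  exact hd

theorem degIdx_one_eq (d d' : DegIdx (MatIdx 1) 1) : d = d' := by
  apply Subtype.ext
  ext i
  rw [eq_i₁ i, degIdx_one_apply, degIdx_one_apply]

/-- **Multiplicities of `ℂ[Sym¹ ℂ] = ℂ[y]` are `≤ 1`**: a torus weight vector is a single power
of the one coordinate `y`. -/
theorem plethysmCoeff_one_le_one (χ : Weight (MatIdx 1)) : plethysmCoeff ℂ (MatIdx 1) 1 χ ≤ 1 := by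
  classical
  -- the unique coordinate index and the only possible exponent
  have hdeg1 : (Finsupp.single i₁ 1 : MatIdx 1 →₀ ℕ) ∈ degMonomials (MatIdx 1) 1 := by
    rw [mem_degMonomials_iff, Finsupp.degree_single]
  set d₁ : DegIdx (MatIdx 1) 1 := ⟨_, hdeg1⟩ with hd₁
  set s₀ : DegIdx (MatIdx 1) 1 →₀ ℕ := Finsupp.single d₁ ((-χ i₁).toNat) with hs₀
  have hle : highestWeightSpace (coordRep (MatIdx 1) ℂ 1) χ ≤
      Submodule.span ℂ {(monomial s₀ (1 : ℂ) : MvPolynomial (DegIdx (MatIdx 1) 1) ℂ)} := by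
    intro F hF
    have hFw := highestWeightSpace_le_weightSpace _ _ hF
    have hsupp : ∀ s ∈ F.support, s = s₀ := by
      intro s hs
      have hw := monWeight_eq_of_mem_weightSpace hFw hs
      have hwi := congrFun hw i₁
      rw [monWeight_apply] at hwi
      have hsum : (∑ d ∈ s.support, s d * d.1 i₁ : ℕ) = s.degree := by
        rw [Finsupp.degree_apply]
        exact Finset.sum_congr rfl fun d _ => by rw [degIdx_one_apply, mul_one]
      rw [hsum] at hwi
      have hdeg : s.degree = (-χ i₁).toNat := by rw [← hwi, neg_neg, Int.toNat_natCast]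
      have hs1 : s = Finsupp.single d₁ (s d₁) := by
        ext d
        rw [degIdx_one_eq d d₁, Finsupp.single_eq_same]
      have hs2 : s.degree = s d₁ := by rw [hs1, Finsupp.degree_single, Finsupp.single_eq_same]
      rw [hs1, ← hs2, hdeg]
    rw [MvPolynomial.as_sum F]
    refine Submodule.sum_mem _ fun s hs => ?_
    rw [hsupp s hs, ← mul_one (MvPolynomial.coeff s₀ F), ← smul_eq_mul, ← MvPolynomial.smul_monomial]
    exact Submodule.smul_mem _ _ (Submodule.subset_span rfl)
  rw [plethysmCoeff, hwMultiplicity]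
  calc Module.finrank ℂ ↥(highestWeightSpace (coordRep (MatIdx 1) ℂ 1) χ)
      ≤ Module.finrank ℂ ↥(Submodule.span ℂ {(monomial s₀ (1 : ℂ) : MvPolynomial (DegIdx (MatIdx 1) 1) ℂ)}) :=
        Submodule.finrank_mono hle
    _ ≤ ({(monomial s₀ (1 : ℂ) : MvPolynomial (DegIdx (MatIdx 1) 1) ℂ)} : Set _).toFinset.card :=
        finrank_span_le_card _
    _ = 1 := by simp

/-- **Every multiplicity of every orbit closure in `Sym¹ ℂ¹` is `≤ 1`** (BLMW's bound by the
plethysm coefficient, `hwMultiplicity_le_of_surjective`, then `plethysmCoeff_one_le_one`). -/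
theorem orbitMultiplicity_one_le_one (f : MvPolynomial (MatIdx 1) ℂ) (χ : Weight (MatIdx 1)) :
    orbitMultiplicity ℂ f 1 χ ≤ 1 := by
  haveI : FiniteDimensional ℂ (highestWeightSpace (coordRep (MatIdx 1) ℂ 1) χ) :=
    finiteDimensional_highestWeightSpace_coordRep_holds one_ne_zero χ
  have h := hwMultiplicity_le_of_surjective
    (⟨(Ideal.Quotient.mkₐ ℂ (orbitVanishingIdeal f 1)).toLinearMap, fun _ => LinearMap.ext fun _ => rfl⟩ :
      (coordRep (MatIdx 1) ℂ 1).IntertwiningMap (orbitCoordRep f 1))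
    (Ideal.Quotient.mkₐ_surjective ℂ _) (isSemisimpleRepresentation_coordRep 1) χ
  exact h.trans (plethysmCoeff_one_le_one χ)

/-- **No witness at `m = 1`**, for any `n`. -/
theorem not_flipBody_one (n : ℕ) : ¬ FlipBody n 1 := by
  rintro ⟨U, r, δ, lam, hU, hcard, hlt⟩
  have h1 := one_le_finrank_truncT_one U r hU δ lam hcard
  have h2 := orbitMultiplicity_one_le_one (paddedPerFormLex ℂ n 1) (flipWeight 1 δ lam)
  omega

/-- The crux with the window's LOWER bound `n ≤ m` deleted. -/
def ValuativeFlipWithoutLowerWindow : Prop :=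
  ∀ c : ℕ, ∃ n₀ : ℕ, ∀ n ≥ n₀, ∀ (m : ℕ) [NeZero m], m ≤ 2 ^ ((Nat.log 2 n + c) ^ c) → FlipBody n m

/-- **Any proof must use `n ≤ m`**: without it `m = 1` is in every window and has no witness. -/
theorem not_valuativeFlipWithoutLowerWindow : ¬ ValuativeFlipWithoutLowerWindow := by
  intro h
  obtain ⟨n₀, hn₀⟩ := h 1
  exact not_flipBody_one n₀ (hn₀ n₀ le_rfl 1 (Nat.one_le_two_pow))

/-- The crux with the eventuality `∃ n₀, ∀ n ≥ n₀` replaced by `∀ n`. -/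
def ValuativeFlipAllN : Prop :=
  ∀ c n : ℕ, ∀ (m : ℕ) [NeZero m], n ≤ m → m ≤ 2 ^ ((Nat.log 2 n + c) ^ c) → FlipBody n m

/-- **Any proof must use the eventuality**: at `n = 1` the `c = 1` window forces `m = 1`. -/
theorem not_valuativeFlipAllN : ¬ ValuativeFlipAllN := fun h =>
  not_flipBody_one 1 (h 1 1 1 le_rfl (self_mem_window_one 1))

end MOne


/-! ## No flip at one-row shapes (natural strengthening refuted; conditional on `CoeffVanishingOrder`)

For `λ = (mδ)` (`δ ≥ 1`) the padded-permanent multiplicity is EXACTLY `1`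
(`orbitMultiplicity_paddedPer_oneRow_eq_one`) and, granted the support item `CoeffVanishingOrder`
(stmt-12628, provable now), `T_U((mδ)*) ∋ det(A_top)^δ ≠ 0` for EVERY admissible `(U, r)`
(`rowTopDet_pow_mem_truncT`); so no truncation ever flips a one-row shape (`no_oneRow_flip`).
A `ValuativeFlip` witness must use a shape with at least two rows (and by F6 an Edmonds-gap `U`). -/

section OneRow

variable {m : ℕ}

/-- The one-row crux weight for general `δ ≥ 1`: `flipWeight m δ (mδ) = -mδ ε_{top}`. -/
theorem flipWeight_indiscrete' (m : ℕ) [NeZero m] {δ : ℕ} (hδ : 0 < δ) :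
    flipWeight m δ (Nat.Partition.indiscrete (m * δ)) = Pi.single (topIdx m) (-((m * δ : ℕ) : ℤ)) := by
  have hm : m * δ ≠ 0 := Nat.mul_ne_zero (NeZero.ne m) hδ.ne'
  have hsorted : (Nat.Partition.indiscrete (m * δ)).sortedParts = [m * δ] := by
    simp [Nat.Partition.sortedParts, Nat.Partition.indiscrete_parts hm]
  have hmm : m * m - 1 < m * m := Nat.sub_one_lt (by simpa using NeZero.ne m)
  funext ij
  simp only [flipWeight, Weight.toMatIdx, Weight.dualOfPartition, Weight.dual, Weight.ofPartition,
    hsorted]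
  by_cases hij : ij = topIdx m
  · subst hij
    have hrev : ((Fin.rev ((matIdxEquiv m).symm (topIdx m)) : Fin (m * m)) : ℕ) = 0 := by
      rw [Fin.val_rev, matIdxEquiv_symm_topIdx_val]
      omega
    rw [Pi.single_eq_same, hrev, List.getD_cons_zero]
  · rw [Pi.single_eq_of_ne hij]
    have hne : (matIdxEquiv m).symm ij ≠ (matIdxEquiv m).symm (topIdx m) :=
      fun h => hij ((matIdxEquiv m).symm.injective h)
    have hval : (((matIdxEquiv m).symm ij : Fin (m * m)) : ℕ) ≠ m * m - 1 := by
      intro h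
      apply hne
      ext
      rw [h, matIdxEquiv_symm_topIdx_val]
    have hlt : (((matIdxEquiv m).symm ij : Fin (m * m)) : ℕ) < m * m := ((matIdxEquiv m).symm ij).2
    obtain ⟨k, hk⟩ : ∃ k, ((Fin.rev ((matIdxEquiv m).symm ij) : Fin (m * m)) : ℕ) = k + 1 :=
      ⟨(m * m - 1 - ((matIdxEquiv m).symm ij : ℕ)) - 1, by rw [Fin.val_rev]; omega⟩
    rw [hk, List.getD_cons_succ, List.getD_nil, Nat.cast_zero, neg_zero]

/-- **The multiplicity of a one-row dual weight `-N ε_{top}` in `k[Sym^m]` is at most `1`**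
(`m ≠ 0`): a torus weight vector of that weight is a multiple of `X_{x_top^m}^{N/m}`. -/
theorem plethysmCoeff_single_top_le_one (hm : m ≠ 0) (N : ℕ) [NeZero m] :
    plethysmCoeff ℂ (MatIdx m) m (Pi.single (topIdx m) (-(N : ℤ))) ≤ 1 := by
  classical
  have hdeg : (Finsupp.single (topIdx m) m : MatIdx m →₀ ℕ) ∈ degMonomials (MatIdx m) m := by
    rw [mem_degMonomials_iff, Finsupp.degree_single]
  set dtop : DegIdx (MatIdx m) m := ⟨_, hdeg⟩ with hdtop
  set s₀ : DegIdx (MatIdx m) m →₀ ℕ := Finsupp.single dtop (N / m) with hs₀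
  have hle : highestWeightSpace (coordRep (MatIdx m) ℂ m) (Pi.single (topIdx m) (-(N : ℤ))) ≤
      Submodule.span ℂ {(monomial s₀ (1 : ℂ) : MvPolynomial (DegIdx (MatIdx m) m) ℂ)} := by
    intro F hF
    have hFw := highestWeightSpace_le_weightSpace _ _ hF
    have hsupp : ∀ s ∈ F.support, s = s₀ := by
      intro s hs
      have hw := monWeight_eq_of_mem_weightSpace hFw hs
      -- every coordinate index in the support of `s` is `x_top^m`
      have hd : ∀ d ∈ s.support, d = dtop := by
        intro d hdmem
        apply Subtype.ext
        have hzero : ∀ i, i ≠ topIdx m → d.1 i = 0 := by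
          intro i hi
          have hwi := congrFun hw i
          rw [monWeight_apply, Pi.single_eq_of_ne hi, neg_eq_zero, Nat.cast_eq_zero,
            Finset.sum_eq_zero_iff] at hwi
          have := hwi d hdmem
          rcases Nat.mul_eq_zero.mp this with h0 | h0
          · exact absurd h0 (Finsupp.mem_support_iff.mp hdmem)
          · exact h0
        have hsub : d.1.support ⊆ {topIdx m} := by
          intro i hi
          rw [Finset.mem_singleton]
          by_contra hne
          exact (Finsupp.mem_support_iff.mp hi) (hzero i hne)
        have hd' : d.1 = Finsupp.single (topIdx m) (d.1 (topIdx m)) := Finsupp.support_subset_singleton.mp hsub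
        have hdegd : d.1.degree = m := mem_degMonomials_iff.mp d.2
        rw [hd', Finsupp.degree_single] at hdegd
        rw [hd', hdegd]
      have hsub : s.support ⊆ {dtop} := fun d hdmem => Finset.mem_singleton.mpr (hd d hdmem)
      have hs' : s = Finsupp.single dtop (s dtop) := Finsupp.support_subset_singleton.mp hsub
      -- the exponent is pinned by the weight at `top`
      have hwt := congrFun hw (topIdx m)
      rw [monWeight_apply, Pi.single_eq_same, neg_inj, Nat.cast_inj] at hwt
      have hsum : ∑ d ∈ s.support, s d * d.1 (topIdx m) = s dtop * m := by
        rw [Finset.sum_subset hsub (fun d _ hd0 => by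
          rw [Finsupp.notMem_support_iff.mp hd0, zero_mul]), Finset.sum_singleton]
        simp [hdtop]
      rw [hsum] at hwt
      have hq : s dtop = N / m := by
        rw [← hwt, Nat.mul_div_cancel _ (Nat.pos_of_ne_zero hm)]
      rw [hs', hq]
    rw [MvPolynomial.as_sum F]
    refine Submodule.sum_mem _ fun s hs => ?_
    rw [hsupp s hs, ← mul_one (MvPolynomial.coeff s₀ F), ← smul_eq_mul, ← MvPolynomial.smul_monomial]
    exact Submodule.smul_mem _ _ (Submodule.subset_span rfl)
  rw [plethysmCoeff, hwMultiplicity]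
  calc Module.finrank ℂ ↥(highestWeightSpace (coordRep (MatIdx m) ℂ m) (Pi.single (topIdx m) (-(N : ℤ))))
      ≤ Module.finrank ℂ ↥(Submodule.span ℂ {(monomial s₀ (1 : ℂ) : MvPolynomial (DegIdx (MatIdx m) m) ℂ)}) :=
        Submodule.finrank_mono hle
    _ ≤ ({(monomial s₀ (1 : ℂ) : MvPolynomial (DegIdx (MatIdx m) m) ℂ)} : Set _).toFinset.card :=
        finrank_span_le_card _
    _ = 1 := by simp

/-- Every orbit closure in `Sym^m ℂ^{m×m}` carries the one-row dual weight with multiplicity `≤ 1`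
(BLMW's equivariant surjection `ℂ[Sym^m] ↠ ℂ[Δ]` and complete reducibility). -/
theorem orbitMultiplicity_single_top_le_one [NeZero m] (f : MvPolynomial (MatIdx m) ℂ) (N : ℕ) :
    orbitMultiplicity ℂ f m (Pi.single (topIdx m) (-(N : ℤ))) ≤ 1 := by
  haveI : FiniteDimensional ℂ (highestWeightSpace (coordRep (MatIdx m) ℂ m) (Pi.single (topIdx m) (-(N : ℤ)))) :=
    finiteDimensional_highestWeightSpace_coordRep_holds (NeZero.ne m) _
  have h := hwMultiplicity_le_of_surjective
    (⟨(Ideal.Quotient.mkₐ ℂ (orbitVanishingIdeal f m)).toLinearMap, fun _ => LinearMap.ext fun _ => rfl⟩ :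
      (coordRep (MatIdx m) ℂ m).IntertwiningMap (orbitCoordRep f m))
    (Ideal.Quotient.mkₐ_surjective ℂ _) (isSemisimpleRepresentation_coordRep m) (Pi.single (topIdx m) (-(N : ℤ)))
  exact h.trans (plethysmCoeff_single_top_le_one (NeZero.ne m) N)

/-- **The one-row multiplicity of the padded permanent is exactly `1`** (`n ≤ m`, `δ ≥ 1`). -/
theorem orbitMultiplicity_paddedPer_oneRow_eq_one (n m : ℕ) [NeZero m] (hnm : n ≤ m) (δ : ℕ) :
    orbitMultiplicity ℂ (paddedPerFormLex ℂ n m) m (Pi.single (topIdx m) (-((m * δ : ℕ) : ℤ))) = 1 := by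
  classical
  refine le_antisymm (orbitMultiplicity_single_top_le_one _ _) ?_
  have hdeg : (Finsupp.single (topIdx m) m : MatIdx m →₀ ℕ) ∈ degMonomials (MatIdx m) m := by
    rw [mem_degMonomials_iff, Finsupp.degree_single]
  set d : DegIdx (MatIdx m) m := ⟨_, hdeg⟩ with hd
  have hX := Literature.Computability.Complexity.X_mem_highestWeightSpace_coordRep (k := ℂ) m (topIdx m)
    (le_topIdx m) d rfl
  have hwc : ∀ (a : ℤ) (g : GL (MatIdx m) ℂ), weightChar (Pi.single (topIdx m) a : Weight (MatIdx m)) g =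
      ((g : Matrix (MatIdx m) (MatIdx m) ℂ) (topIdx m) (topIdx m)) ^ a := by
    intro a g
    rw [weightChar, Finset.prod_eq_single (topIdx m) (fun j _ hj => by rw [Pi.single_eq_of_ne hj, zpow_zero])
      (fun h => absurd (Finset.mem_univ _) h), Pi.single_eq_same]
  have hXδ : (X d : MvPolynomial (DegIdx (MatIdx m) m) ℂ) ^ δ ∈
      highestWeightSpace (coordRep (MatIdx m) ℂ m) (Pi.single (topIdx m) (-((m * δ : ℕ) : ℤ))) := by
    intro g hg
    rw [coordRep_apply, map_pow, ← coordRep_apply, hX g hg, smul_pow, hwc, hwc, ← zpow_natCast, ← zpow_mul]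
    congr 2
    push_cast
    ring
  have hmk := mk_mem_highestWeightSpace_orbitCoordRep (paddedPerFormLex ℂ n m) hXδ
  have hprime := orbitVanishingIdeal_isPrime (paddedPerFormLex ℂ n m) m
  have hne : Ideal.Quotient.mk (orbitVanishingIdeal (paddedPerFormLex ℂ n m) m)
      ((X d : MvPolynomial (DegIdx (MatIdx m) m) ℂ) ^ δ) ≠ 0 := fun h0 =>
    X_top_not_mem_orbitVanishingIdeal_paddedPer n m hnm d rfl
      (hprime.mem_of_pow_mem δ (Ideal.Quotient.eq_zero_iff_mem.mp h0))
  haveI := finiteDimensional_highestWeightSpace_orbitCoordRep_holds (k := ℂ) (paddedPerFormLex ℂ n m)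
    (NeZero.ne m) (Pi.single (topIdx m) (-((m * δ : ℕ) : ℤ)))
  rw [orbitMultiplicity, hwMultiplicity, Submodule.one_le_finrank_iff]
  intro hbot
  rw [hbot, Submodule.mem_bot] at hmk
  exact hne hmk

/-! ### The explicit generator `det(A_top)^δ` of `T₀((mδ)*)` -/

/-- Evaluating a linear substitution instance over any commutative ring:
`(A · f)(x) = f(Aᵀ x)`. -/
theorem eval_linSubst_ring {R σ : Type*} [CommRing R] [Fintype σ] (A : Matrix σ σ R) (x : σ → R)
    (f : MvPolynomial σ R) :
    MvPolynomial.eval x (linSubst σ R A f) = MvPolynomial.eval (fun i => ∑ j, A j i * x j) f := by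
  have h : (MvPolynomial.aeval x).comp (linSubst σ R A) =
      MvPolynomial.aeval (R := R) fun i => ∑ j, A j i * x j := by
    rw [linSubst, MvPolynomial.comp_aeval]
    congr 1
    funext i
    simp [map_sum, smul_eq_mul]
  have := congrArg (fun φ : MvPolynomial σ R →ₐ[R] R => φ f) h
  simpa using this

/-- Evaluation of a form of degree `N` at the coordinate point `e_v` returns the coefficient of
`X_v^N` (any commutative ring). -/
theorem eval_pi_single_of_isHomogeneous_ring {R σ : Type*} [CommRing R] [DecidableEq σ]
    {p : MvPolynomial σ R} {N : ℕ} (hp : p.IsHomogeneous N) (v : σ) :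
    MvPolynomial.eval (Pi.single v 1) p = MvPolynomial.coeff (Finsupp.single v N) p := by
  classical
  rw [MvPolynomial.eval_eq]
  have hterm : ∀ d ∈ p.support, MvPolynomial.coeff d p * ∏ i ∈ d.support, (Pi.single v (1 : R) : σ → R) i ^ d i =
      if d = Finsupp.single v N then MvPolynomial.coeff d p else 0 := by
    intro d hd
    by_cases hsub : d.support ⊆ {v}
    · have hd' : d = Finsupp.single v (d v) := Finsupp.support_subset_singleton.mp hsub
      have hdeg : d v = N := by
        have h1 := hp (MvPolynomial.mem_support_iff.mp hd)
        have h1' : d.degree = N := by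
          rw [Finsupp.degree_eq_weight_one]
          exact h1
        rw [hd', Finsupp.degree_single] at h1'
        exact h1'
      have hdv : d = Finsupp.single v N := by rw [← hdeg]; exact hd'
      rw [if_pos hdv]
      have : ∏ i ∈ d.support, (Pi.single v (1 : R) : σ → R) i ^ d i = 1 := by
        refine Finset.prod_eq_one fun i hi => ?_
        have hi' : i = v := Finset.mem_singleton.mp (hsub hi)
        subst hi'
        simp
      rw [this, mul_one]
    · have hne : d ≠ Finsupp.single v N := by
        rintro rfl
        exact hsub Finsupp.support_single_subset
      rw [if_neg hne]
      obtain ⟨i, hi, hiv⟩ : ∃ i ∈ d.support, i ≠ v := by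
        by_contra hcon
        exact hsub fun i hi => Finset.mem_singleton.mpr (by_contra fun hiv => hcon ⟨i, hi, hiv⟩)
      have hzero : (Pi.single v (1 : R) : σ → R) i ^ d i = 0 := by
        rw [Pi.single_eq_of_ne hiv, zero_pow (Finsupp.mem_support_iff.mp hi)]
      rw [Finset.prod_eq_zero hi hzero, mul_zero]
  rw [Finset.sum_congr rfl hterm, Finset.sum_ite_eq']
  split_ifs with h
  · rfl
  · exact (MvPolynomial.notMem_support_iff.mp h).symm

/-- `det(A_top)`: the determinant of the greatest row of `A`, i.e. `det_m` renamed into the row-`top`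
variables `X_(top, i)`. -/
def rowTopDet (m : ℕ) [NeZero m] : MvPolynomial (MatIdx m × MatIdx m) ℂ :=
  MvPolynomial.rename (fun i : MatIdx m => (topIdx m, i)) (detFormLex ℂ m)

/-- `eval (X ∘ ι) (map C p) = rename ι p`. -/
theorem eval_X_comp_map_C {σ τ : Type*} (ι : σ → τ) (p : MvPolynomial σ ℂ) :
    MvPolynomial.eval (fun i => (X (ι i) : MvPolynomial τ ℂ)) (MvPolynomial.map C p) = MvPolynomial.rename ι p := by
  rw [MvPolynomial.eval_map, MvPolynomial.rename_eq_aeval]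
  rfl

/-- **The top coefficient of `det_m(xA)` is `det(A_top)`**: this identifies the instance
`d = x_top^m` of the support item `CoeffVanishingOrder` (stmt-12628). -/
theorem coeffVanishingOrder_top (m : ℕ) [NeZero m] (d : DegIdx (MatIdx m) m)
    (hd : d.1 = Finsupp.single (topIdx m) m) :
    (MvPolynomial.aeval (R := ℂ) fun d : DegIdx (MatIdx m) m => MvPolynomial.coeff d.1
        (linSubst (MatIdx m) (MvPolynomial (MatIdx m × MatIdx m) ℂ)
          (Matrix.of fun j i : MatIdx m => MvPolynomial.X (j, i))
          (MvPolynomial.map MvPolynomial.C (detFormLex ℂ m)))) (MvPolynomial.X d) = rowTopDet m := by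
  classical
  rw [MvPolynomial.aeval_X, hd]
  have hhom : (linSubst (MatIdx m) (MvPolynomial (MatIdx m × MatIdx m) ℂ)
      (Matrix.of fun j i : MatIdx m => MvPolynomial.X (j, i))
      (MvPolynomial.map MvPolynomial.C (detFormLex ℂ m))).IsHomogeneous m :=
    linSubst_isHomogeneous _ ((detFormLex_isHomogeneous ℂ m).map _)
  rw [← eval_pi_single_of_isHomogeneous_ring hhom (topIdx m), eval_linSubst_ring]
  have hpt : (fun i : MatIdx m => ∑ j : MatIdx m, (Matrix.of fun j i : MatIdx m =>
      (MvPolynomial.X (j, i) : MvPolynomial (MatIdx m × MatIdx m) ℂ)) j i *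
        (Pi.single (topIdx m) (1 : MvPolynomial (MatIdx m × MatIdx m) ℂ) : MatIdx m → _) j) =
      fun i => (X (topIdx m, i) : MvPolynomial (MatIdx m × MatIdx m) ℂ) := by
    funext i
    rw [Finset.sum_eq_single (topIdx m) (fun j _ hj => by rw [Pi.single_eq_of_ne hj, mul_zero])
      (fun h => absurd (Finset.mem_univ _) h), Pi.single_eq_same, mul_one, Matrix.of_apply]
  rw [hpt, eval_X_comp_map_C, rowTopDet]

/-- `rowTopDet ≠ 0`. -/
theorem rowTopDet_ne_zero (m : ℕ) [NeZero m] : rowTopDet m ≠ 0 := by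
  rw [rowTopDet, Ne, ← map_zero (MvPolynomial.rename (fun i : MatIdx m => (topIdx m, i))),
    (MvPolynomial.rename_injective _ (fun a b h => (Prod.mk.inj h).2)).eq_iff]
  exact Literature.Computability.Complexity.detFormLex_ne_zero m

/-- Rescaling the variables of a form of degree `N` by a constant `c` and renaming: `c^N • rename`. -/
theorem aeval_const_smul_X_comp {σ τ : Type*} {p : MvPolynomial σ ℂ} {N : ℕ} (hp : p.IsHomogeneous N)
    (c : ℂ) (ι : σ → τ) :
    MvPolynomial.aeval (fun i => c • (X (ι i) : MvPolynomial τ ℂ)) p = c ^ N • MvPolynomial.rename ι p := by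
  classical
  have key : ∀ s ∈ p.support, MvPolynomial.aeval (fun i => c • (X (ι i) : MvPolynomial τ ℂ)) (monomial s (MvPolynomial.coeff s p)) =
      c ^ N • MvPolynomial.rename ι (monomial s (MvPolynomial.coeff s p)) := by
    intro s hs
    have hdeg : s.degree = N := by
      have := hp (MvPolynomial.mem_support_iff.mp hs)
      rw [Finsupp.degree_eq_weight_one]
      exact this
    rw [MvPolynomial.rename_eq_aeval, MvPolynomial.aeval_monomial, MvPolynomial.aeval_monomial, Finsupp.prod,
      Finsupp.prod, MvPolynomial.algebraMap_eq]
    have hprod : ∏ i ∈ s.support, (c • (X (ι i) : MvPolynomial τ ℂ)) ^ s i =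
        C (c ^ N) * ∏ i ∈ s.support, (X (ι i) : MvPolynomial τ ℂ) ^ s i := by
      simp only [MvPolynomial.smul_eq_C_mul, mul_pow, Finset.prod_mul_distrib, ← map_pow]
      rw [← map_prod, Finset.prod_pow_eq_pow_sum, ← Finsupp.degree_apply, hdeg]
    simp only [Function.comp_apply]
    rw [hprod, MvPolynomial.smul_eq_C_mul]
    ring
  calc MvPolynomial.aeval (fun i => c • (X (ι i) : MvPolynomial τ ℂ)) p
      = MvPolynomial.aeval (fun i => c • (X (ι i) : MvPolynomial τ ℂ)) (∑ s ∈ p.support, monomial s (MvPolynomial.coeff s p)) := by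
        rw [← MvPolynomial.as_sum]
    _ = ∑ s ∈ p.support, MvPolynomial.aeval (fun i => c • (X (ι i) : MvPolynomial τ ℂ)) (monomial s (MvPolynomial.coeff s p)) :=
        map_sum _ _ _
    _ = ∑ s ∈ p.support, c ^ N • MvPolynomial.rename ι (monomial s (MvPolynomial.coeff s p)) :=
        Finset.sum_congr rfl key
    _ = c ^ N • MvPolynomial.rename ι p := by
        rw [← Finset.smul_sum, ← map_sum, ← MvPolynomial.as_sum]

/-- **Stabiliser invariance of `det(A_top)`**: transport of `linSubst M det = det` along the
row-`top` renaming. -/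
theorem stabSubst_rowTopDet [NeZero m] (M : Matrix (MatIdx m) (MatIdx m) ℂ)
    (hM : linSubst (MatIdx m) ℂ M (detFormLex ℂ m) = detFormLex ℂ m) :
    MvPolynomial.aeval (R := ℂ) (fun p : MatIdx m × MatIdx m => ∑ l : MatIdx m,
      M l p.2 • (MvPolynomial.X (p.1, l) : MvPolynomial (MatIdx m × MatIdx m) ℂ)) (rowTopDet m) = rowTopDet m := by
  rw [rowTopDet, MvPolynomial.aeval_rename]
  conv_rhs => rw [← hM]
  rw [linSubst, MvPolynomial.comp_aeval_apply]
  have hfun : ((fun p : MatIdx m × MatIdx m => ∑ l : MatIdx m,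
      M l p.2 • (MvPolynomial.X (p.1, l) : MvPolynomial (MatIdx m × MatIdx m) ℂ)) ∘ fun i : MatIdx m => (topIdx m, i)) =
      fun i => MvPolynomial.rename (fun i : MatIdx m => (topIdx m, i))
        (∑ j : MatIdx m, M j i • (X j : MvPolynomial (MatIdx m) ℂ)) := by
    funext i
    simp only [Function.comp_apply, map_sum, map_smul, MvPolynomial.rename_X]
  rw [hfun]

/-- **Borel action on `det(A_top)`**: an upper triangular `g` rescales the top row by
`(g_{top,top})⁻¹`, so `det(A_top) ↦ (g_{top,top})^{-m} det(A_top)`. -/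
theorem borelSubst_rowTopDet [NeZero m] {g : GL (MatIdx m) ℂ} (hg : IsUpperTriangular g) :
    MvPolynomial.aeval (R := ℂ) (fun p : MatIdx m × MatIdx m => ∑ l : MatIdx m,
      ((g⁻¹ : GL (MatIdx m) ℂ) : Matrix (MatIdx m) (MatIdx m) ℂ) p.1 l •
        (MvPolynomial.X (l, p.2) : MvPolynomial (MatIdx m × MatIdx m) ℂ)) (rowTopDet m) =
      (((g : Matrix (MatIdx m) (MatIdx m) ℂ) (topIdx m) (topIdx m))⁻¹) ^ m • rowTopDet m := by
  have hg' : IsUpperTriangular g⁻¹ := (borelSubgroup (MatIdx m) ℂ).inv_mem hg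
  rw [rowTopDet, MvPolynomial.aeval_rename]
  have hfun : ((fun p : MatIdx m × MatIdx m => ∑ l : MatIdx m,
      ((g⁻¹ : GL (MatIdx m) ℂ) : Matrix (MatIdx m) (MatIdx m) ℂ) p.1 l •
        (MvPolynomial.X (l, p.2) : MvPolynomial (MatIdx m × MatIdx m) ℂ)) ∘ fun i : MatIdx m => (topIdx m, i)) =
      fun i => (((g : Matrix (MatIdx m) (MatIdx m) ℂ) (topIdx m) (topIdx m))⁻¹) •
        (X ((fun i : MatIdx m => (topIdx m, i)) i) : MvPolynomial (MatIdx m × MatIdx m) ℂ) := by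
    funext i
    simp only [Function.comp_apply]
    rw [Finset.sum_eq_single (topIdx m) (fun l _ hl => by
        rw [hg'.apply_eq_zero (lt_of_le_of_ne (le_topIdx m l) hl), zero_smul])
      (fun h => absurd (Finset.mem_univ _) h), inv_apply_diag_of_isUpperTriangular' hg]
  rw [hfun, aeval_const_smul_X_comp (detFormLex_isHomogeneous ℂ m)]

/-- **`det(A_top)^δ ∈ T_U((mδ)*)`** for every `(U, r)`, granted the valuative estimate for the top
coefficient (`hvan`, an instance of `CoeffVanishingOrder`). -/
theorem rowTopDet_pow_mem_truncT [NeZero m] (U : Submodule ℂ (MatIdx m → ℂ)) (r : ℕ) {δ : ℕ} (hδ : 0 < δ)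
    (hvan : rowTopDet m ∈ (MvPolynomial.vanishingIdeal ℂ
      {p : MatIdx m × MatIdx m → ℂ | ∀ j : MatIdx m, (fun i => p (j, i)) ∈ U}) ^ (m - r)) :
    rowTopDet m ^ δ ∈ truncT m U r δ (flipWeight m δ (Nat.Partition.indiscrete (m * δ))) := by
  rw [flipWeight_indiscrete' m hδ]
  simp only [truncT, Submodule.mem_inf, Submodule.mem_iInf, LinearMap.mem_ker, LinearMap.sub_apply,
    LinearMap.smul_apply, LinearMap.id_apply, AlgHom.toLinearMap_apply, sub_eq_zero, Submodule.restrictScalars_mem]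
  refine ⟨⟨⟨?_, ?_⟩, fun M hM => ?_⟩, fun g hg => ?_⟩
  · rw [MvPolynomial.mem_homogeneousSubmodule]
    exact ((detFormLex_isHomogeneous ℂ m).rename_isHomogeneous).pow δ
  · have := Ideal.pow_mem_pow hvan δ
    rwa [← pow_mul, mul_comm] at this
  · rw [map_pow, stabSubst_rowTopDet M hM]
  · rw [map_pow, borelSubst_rowTopDet hg, smul_pow, ← pow_mul, weightChar,
      Finset.prod_eq_single (topIdx m) (fun j _ hj => by rw [Pi.single_eq_of_ne hj, zpow_zero])
        (fun h => absurd (Finset.mem_univ _) h), Pi.single_eq_same, zpow_neg, zpow_natCast, inv_pow]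

/-- **No flip at one-row shapes** (conditional on the support item `CoeffVanishingOrder`,
stmt-12628): for every `n ≤ m`, every admissible `(U, r)` and every `δ ≥ 1`,
`dim T_U((mδ)*) ≥ 1 = mult_{(mδ)*} ℂ[Δ(X₀₀^{m-n} per_n)]`.  The natural strengthening of the crux
"a flip exists at a one-row shape" is refuted; witnesses need `≥ 2` rows. -/
theorem no_oneRow_flip (hCVO : CoeffVanishingOrder) (n m : ℕ) [NeZero m]
    (U : Submodule ℂ (MatIdx m → ℂ)) (r : ℕ) (hU : RankLE m U r) {δ : ℕ} (hδ : 0 < δ) :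
    ¬ Module.finrank ℂ ↥(truncT m U r δ (flipWeight m δ (Nat.Partition.indiscrete (m * δ)))) <
        orbitMultiplicity ℂ (paddedPerFormLex ℂ n m) m (flipWeight m δ (Nat.Partition.indiscrete (m * δ))) := by
  classical
  have hdeg : (Finsupp.single (topIdx m) m : MatIdx m →₀ ℕ) ∈ degMonomials (MatIdx m) m := by
    rw [mem_degMonomials_iff, Finsupp.degree_single]
  have hvan : rowTopDet m ∈ (MvPolynomial.vanishingIdeal ℂ
      {p : MatIdx m × MatIdx m → ℂ | ∀ j : MatIdx m, (fun i => p (j, i)) ∈ U}) ^ (m - r) := by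
    have := hCVO m U r hU ⟨_, hdeg⟩
    rwa [coeffVanishingOrder_top m ⟨_, hdeg⟩ rfl] at this
  have hmem := rowTopDet_pow_mem_truncT U r hδ hvan
  have hmult : orbitMultiplicity ℂ (paddedPerFormLex ℂ n m) m (flipWeight m δ (Nat.Partition.indiscrete (m * δ))) ≤ 1 := by
    rw [flipWeight_indiscrete' m hδ]
    exact orbitMultiplicity_single_top_le_one _ _
  have hfin : 1 ≤ Module.finrank ℂ ↥(truncT m U r δ (flipWeight m δ (Nat.Partition.indiscrete (m * δ)))) := by
    haveI : Module.Finite ℂ (MvPolynomial.homogeneousSubmodule (MatIdx m × MatIdx m) ℂ (m * δ)) :=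
      finite_homogeneousSubmodule _ ℂ _
    haveI : Module.Finite ℂ ↥(truncT m U r δ (flipWeight m δ (Nat.Partition.indiscrete (m * δ)))) :=
      Submodule.finiteDimensional_of_le ((truncT_le_truncT₀ m U r δ _).trans fun G hG => by
        simp only [truncT₀, Submodule.mem_inf] at hG
        exact hG.1.1)
    rw [Submodule.one_le_finrank_iff]
    intro hbot
    rw [hbot, Submodule.mem_bot] at hmem
    exact pow_ne_zero δ (rowTopDet_ne_zero m) hmem
  omega

end OneRow

end Summit.ValiantsHypothesis.ValiantsHypothesis.Cruxes.ValuativeFlip.Disproof
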